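import Literature.NumberTheory.LFunctions.GaussianHeckeTwistedSum
import Literature.NumberTheory.LFunctions.GaussianHeckeVKRegion
import Literature.NumberTheory.LFunctions.GaussianHeckePrimeSumBookkeeping
import Literature.NumberTheory.LFunctions.GaussianHeckeRichertBound
import Literature.NumberTheory.LFunctions.GaussianHeckeColemanZFR
import Literature.NumberTheory.LFunctions.GaussianLineSumVinogradov
import HarnessLib

/-!
# Harman's Lemma 11.6: `harman_primeCharSum_bound_of_vk` (from a Coleman-type zero-free region) and,
# unconditionally, `harman_primeCharSum_bound_holds` (Coleman's Theorem 1 for `ℚ(i)` proved in Part B)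

Topic `Literature/NumberTheory/LFunctions`.  We PROVE the named fact
`Literature.NumberTheory.LFunctions.GaussianInt.harman_primeCharSum_bound` (G. Harman, *Prime-Detecting
Sieves*, Lemma 11.6: for `R, U ≥ 2`, `T ≥ S ≥ R + exp((log UT)^{4/5})`, `1 ≤ m ≤ T`, `|t| ≤ U`,
`|∑_{R ≤ |p|² < S} |p|^{2it} λ^m(p)| ≤ C S exp(-log S/(2 (log TU)^{7/10}))`) CONDITIONALLY on a
Vinogradov–Korobov zero-free region for the Hecke `L`-functions `L(s, λ^m)` of `ℚ(i)` in the printed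
(Coleman 1990, Thm 2) shape, i.e. on the predicate
`Literature.NumberTheory.LFunctions.GaussianHecke.HasVKZeroFreeRegion c V₀` (`GaussianHeckeVKRegion.lean`):

* `GaussianInt.harman_primeCharSum_bound_of_vk (hc : 0 < c) (hVK : HasVKZeroFreeRegion c V₀) :
    harman_primeCharSum_bound` (Part A);
* `GaussianHecke.exists_latticeExpSumBound : ∃ C D, 0 ≤ C ∧ 0 < D ∧ GaussianHecke.LatticeExpSumBound C D` (Part B:
  Vinogradov's estimate for the lattice sums `∑_{M < N z ≤ u} λ^m(z) N(z)^{-it}` — M. D. Coleman's Theorem 1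
  (Mathematika 37 (1990)) for `ℚ(i)`, conductor `1` — by Vinogradov's method on the lines `Im z = b` of `ℤ[i]`,
  `GaussLine.norm_lineSum_le`);
* `GaussianInt.harman_primeCharSum_bound_holds : harman_primeCharSum_bound` — UNCONDITIONALLY (Part C): Part B, the
  Richert-type bound `GaussianHecke.exists_richert_of_latticeExpSumBound` and the Landau–Titchmarsh deduction
  `GaussianHecke.exists_hasVKZeroFreeRegion_of_latticeExpSumBound` (Coleman's Theorem 2) feed Part A.

Harman's printed proof is one sentence ("in the same way as for rational primes, since the Hecke
`L`-functions have a similar zero-free region [Coleman]"); the argument formalised here is Landau's: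
with `ℓ = log TU`, `δ = 16 ℓ^{-7/10}` (inside the Coleman region at scale `TU` for `ℓ` large,
`GaussianHecke.eventually_zeroFree_of_vk`), Perron height `(TU)²` and `η = exp(-log S/(2ℓ^{7/10}))`, the
twisted prime-power sums `∑_{n ≤ N} ½ l_m(n) n^{it}` are `≤ 9ηN` for `Sη/12 ≤ N ≤ S`
(`GaussianHecke.exists_norm_twistedSum_le` with `h = ηN`, de la Vallée-Poussin's `ψ(N+h) - ψ(N) ≤ h + …`),
hence the twisted `θ`-sums are `≤ 19ηS` up to `S` (trivially `≤ 12N` below `Sη/12`), and Abel summation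
(`GaussianHecke.norm_sum_Icc_mul_le_of_antitone`) removes the weights `log N(p)`; for `ℓ` below the
threshold the trivial bound `9S` is absorbed in the constant.

## References

* G. Harman, *Prime-Detecting Sieves*, Princeton UP 2007, §11.4, Lemma 11.6 (11.4.5). [Harman2007]
* M. D. Coleman, *A zero-free region for the Hecke L-functions*, Mathematika 37 (1990), 287–304, Thm 2.
  [ColemanMathematika1990]
* H. L. Montgomery, R. C. Vaughan, *Multiplicative Number Theory I*, CUP 2007, §6.2. [MontgomeryVaughan2007]
* A. Ivić, *The Riemann Zeta-Function*, Wiley 1985, Theorem 6.2 (the rational model of Part B). [Ivic1985]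
-/

noncomputable section

open Complex Filter Topology Asymptotics Finset
open scoped ArithmeticFunction.vonMangoldt

namespace Literature.NumberTheory.LFunctions

namespace GaussianHecke

open GaussianInt

/-! ### Growth lemmas in `ℓ = log TU` -/

/-- The Coleman denominator at scale `e^ℓ` is `o(ℓ^{7/10})`:
`(2ℓ + log 4)^{2/3} (log(2ℓ + log 4))^{1/3} = o(ℓ^{7/10})`, hence eventually `≤ (c/16) ℓ^{7/10}`.
[folklore] -/
theorem eventually_vkDen_le {c : ℝ} (hc : 0 < c) :
    ∀ᶠ ℓ : ℝ in atTop, 16 * (Real.log (4 * Real.exp ℓ ^ 2) ^ (2 / 3 : ℝ) *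
      Real.log (Real.log (4 * Real.exp ℓ ^ 2)) ^ (1 / 3 : ℝ)) ≤ c * ℓ ^ (7 / 10 : ℝ) := by
  -- `u(ℓ) = log(4 e^{2ℓ}) = 2ℓ + log 4`
  have hu_eq : ∀ ℓ : ℝ, Real.log (4 * Real.exp ℓ ^ 2) = 2 * ℓ + Real.log 4 := fun ℓ ↦ by
    rw [Real.log_mul (by norm_num) (by positivity), Real.log_pow, Real.log_exp]; push_cast; ring
  have hlog4 : 0 < Real.log 4 := Real.log_pos (by norm_num)
  have hu : Tendsto (fun ℓ : ℝ ↦ 2 * ℓ + Real.log 4) atTop atTop :=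
    tendsto_atTop_add_const_right _ _ (Tendsto.const_mul_atTop (by norm_num) tendsto_id)
  have hlog4' : Real.log 4 ≤ 2 := by
    have h4 : Real.log 4 = 2 * Real.log 2 := by
      rw [show (4 : ℝ) = 2 ^ 2 by norm_num, Real.log_pow]; norm_num
    have := Real.log_two_lt_d9; linarith
  -- `u^{2/3} = O(ℓ^{2/3})`
  have h1 : (fun ℓ : ℝ ↦ (2 * ℓ + Real.log 4) ^ (2 / 3 : ℝ)) =O[atTop] fun ℓ : ℝ ↦ ℓ ^ (2 / 3 : ℝ) := by
    refine IsBigO.of_bound (4 ^ (2 / 3 : ℝ)) ?_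
    filter_upwards [eventually_ge_atTop (1 : ℝ)] with ℓ hℓ
    have h24 : 0 ≤ 2 * ℓ + Real.log 4 := by linarith
    rw [Real.norm_of_nonneg (Real.rpow_nonneg h24 _), Real.norm_of_nonneg (Real.rpow_nonneg (by linarith) _),
      ← Real.mul_rpow (by norm_num) (by linarith)]
    exact Real.rpow_le_rpow h24 (by linarith) (by norm_num)
  -- `(log u)^{1/3} = o(ℓ^{1/30})`
  have h2 : (fun ℓ : ℝ ↦ Real.log (2 * ℓ + Real.log 4) ^ (1 / 3 : ℝ)) =o[atTop]
      fun ℓ : ℝ ↦ ℓ ^ (1 / 30 : ℝ) := by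
    have h2a : (fun ℓ : ℝ ↦ Real.log (2 * ℓ + Real.log 4)) =o[atTop]
        fun ℓ : ℝ ↦ (2 * ℓ + Real.log 4) ^ (1 / 10 : ℝ) :=
      (isLittleO_log_rpow_atTop (by norm_num)).comp_tendsto hu
    have h2b : (fun ℓ : ℝ ↦ (2 * ℓ + Real.log 4) ^ (1 / 10 : ℝ)) =O[atTop] fun ℓ : ℝ ↦ ℓ ^ (1 / 10 : ℝ) := by
      refine IsBigO.of_bound (4 ^ (1 / 10 : ℝ)) ?_
      filter_upwards [eventually_ge_atTop (1 : ℝ)] with ℓ hℓ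
      have h24 : 0 ≤ 2 * ℓ + Real.log 4 := by linarith
      rw [Real.norm_of_nonneg (Real.rpow_nonneg h24 _), Real.norm_of_nonneg (Real.rpow_nonneg (by linarith) _),
        ← Real.mul_rpow (by norm_num) (by linarith)]
      exact Real.rpow_le_rpow h24 (by linarith) (by norm_num)
    have h2c := h2a.trans_isBigO h2b
    have h2d := h2c.rpow (r := (1 / 3 : ℝ)) (by norm_num) ?_
    · refine h2d.congr' EventuallyEq.rfl ?_
      filter_upwards [eventually_ge_atTop (0 : ℝ)] with ℓ hℓ
      rw [← Real.rpow_mul hℓ]; norm_num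
    · filter_upwards [eventually_ge_atTop (1 : ℝ)] with ℓ hℓ
      exact Real.rpow_nonneg (by linarith) _
  have h3 := h1.mul_isLittleO h2
  have h4 : (fun ℓ : ℝ ↦ ℓ ^ (2 / 3 : ℝ) * ℓ ^ (1 / 30 : ℝ)) =ᶠ[atTop] fun ℓ : ℝ ↦ ℓ ^ (7 / 10 : ℝ) := by
    filter_upwards [eventually_gt_atTop (0 : ℝ)] with ℓ hℓ
    rw [← Real.rpow_add hℓ]; norm_num
  have h5 := h3.congr' EventuallyEq.rfl h4
  have h6 := h5.def (show 0 < c / 16 by positivity)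
  filter_upwards [h6, eventually_ge_atTop (1 : ℝ)] with ℓ hℓ hℓ1
  rw [hu_eq]
  have hnn : 0 ≤ (2 * ℓ + Real.log 4) ^ (2 / 3 : ℝ) * Real.log (2 * ℓ + Real.log 4) ^ (1 / 3 : ℝ) := by
    have : 0 ≤ Real.log (2 * ℓ + Real.log 4) := Real.log_nonneg (by linarith)
    positivity
  rw [Real.norm_of_nonneg hnn, Real.norm_of_nonneg (by positivity)] at hℓ
  linarith

/-- The de la Vallée-Poussin saving beats `η`: for all large `ℓ` and `ℓ^{4/5} ≤ σ ≤ ℓ`,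
`A ≤ c₁ √(σ/2) - σ/(2 ℓ^{7/10})` (any `A`; since the right side is `≥ (c₁/4) √σ ≥ (c₁/4) ℓ^{2/5}` once
`ℓ^{1/5} ≥ 2/c₁`). [folklore] -/
theorem eventually_dlVP_saving {c₁ : ℝ} (hc₁ : 0 < c₁) (A : ℝ) :
    ∀ᶠ ℓ : ℝ in atTop, ∀ σ : ℝ, ℓ ^ (4 / 5 : ℝ) ≤ σ → σ ≤ ℓ →
      A ≤ c₁ * Real.sqrt (σ / 2) - σ / (2 * ℓ ^ (7 / 10 : ℝ)) := by
  have hκ : 0 < c₁ / 4 := by positivity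
  filter_upwards [eventually_ge_atTop (1 : ℝ),
    (tendsto_rpow_atTop (by norm_num : (0 : ℝ) < 1 / 5)).eventually_ge_atTop (2 / c₁),
    (tendsto_rpow_atTop (by norm_num : (0 : ℝ) < 2 / 5)).eventually_ge_atTop (A / (c₁ / 4))]
    with ℓ hℓ1 hℓ5 hℓ25 σ hσ1 hσ2
  have hℓ0 : 0 < ℓ := by linarith
  have hσ0 : 0 < σ := lt_of_lt_of_le (Real.rpow_pos_of_pos hℓ0 _) hσ1
  set r : ℝ := Real.sqrt σ with hr
  have hr0 : 0 < r := Real.sqrt_pos.mpr hσ0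
  have hrσ : r ^ 2 = σ := Real.sq_sqrt hσ0.le
  -- `√(σ/2) ≥ r/2` (indeed `= r/√2`)
  have hsq : r / 2 ≤ Real.sqrt (σ / 2) := by
    rw [Real.le_sqrt (by positivity) (by positivity)]
    nlinarith
  -- `σ/(2ℓ^{7/10}) ≤ r/(2 ℓ^{1/5})` since `r ≤ ℓ^{1/2}`
  have hrℓ : r ≤ ℓ ^ (1 / 2 : ℝ) := by
    rw [hr, Real.sqrt_eq_rpow]; exact Real.rpow_le_rpow hσ0.le hσ2 (by norm_num)
  have h7 : 0 < ℓ ^ (7 / 10 : ℝ) := Real.rpow_pos_of_pos hℓ0 _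
  have h15 : 0 < ℓ ^ (1 / 5 : ℝ) := Real.rpow_pos_of_pos hℓ0 _
  have hfrac : σ / (2 * ℓ ^ (7 / 10 : ℝ)) ≤ r / (2 * ℓ ^ (1 / 5 : ℝ)) := by
    -- `σ = r · r ≤ r · ℓ^{1/2} = r ℓ^{1/5} ℓ^{-7/10} ℓ^{7/10}` … simpler: cross-multiply
    rw [div_le_div_iff₀ (by positivity) (by positivity)]
    have hhalf : ℓ ^ (1 / 2 : ℝ) * ℓ ^ (1 / 5 : ℝ) = ℓ ^ (7 / 10 : ℝ) := by
      rw [← Real.rpow_add hℓ0]; norm_num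
    calc σ * (2 * ℓ ^ (1 / 5 : ℝ)) = r * (r * ℓ ^ (1 / 5 : ℝ)) * 2 := by rw [← hrσ]; ring
      _ ≤ r * (ℓ ^ (1 / 2 : ℝ) * ℓ ^ (1 / 5 : ℝ)) * 2 := by gcongr
      _ = r * (2 * ℓ ^ (7 / 10 : ℝ)) := by rw [hhalf]; ring
  -- `1/(2 ℓ^{1/5}) ≤ c₁/4`
  have hsmall : r / (2 * ℓ ^ (1 / 5 : ℝ)) ≤ c₁ / 4 * r := by
    rw [div_le_iff₀ (by positivity)]
    have : 2 ≤ c₁ * ℓ ^ (1 / 5 : ℝ) := by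
      have := (div_le_iff₀ hc₁).mp hℓ5; linarith
    nlinarith
  -- `r ≥ ℓ^{2/5}`
  have hr25 : ℓ ^ (2 / 5 : ℝ) ≤ r := by
    rw [hr, Real.le_sqrt (Real.rpow_nonneg hℓ0.le _) hσ0.le, ← Real.rpow_natCast,
      ← Real.rpow_mul hℓ0.le]
    norm_num
    exact hσ1
  have hA : A ≤ c₁ / 4 * ℓ ^ (2 / 5 : ℝ) := by
    have := (div_le_iff₀ hκ).mp hℓ25; linarith
  calc A ≤ c₁ / 4 * ℓ ^ (2 / 5 : ℝ) := hA
    _ ≤ c₁ / 4 * r := by gcongr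
    _ = c₁ * (r / 2) - c₁ / 4 * r := by ring
    _ ≤ c₁ * Real.sqrt (σ / 2) - r / (2 * ℓ ^ (1 / 5 : ℝ)) := by gcongr
    _ ≤ c₁ * Real.sqrt (σ / 2) - σ / (2 * ℓ ^ (7 / 10 : ℝ)) := by linarith


/-! ### The analytic range `Sη/12 ≤ N ≤ S` -/

/-- **`‖∑_{n ≤ N} ½ l_m(n) n^{it}‖ ≤ 9ηN` in the analytic range.**  Pure bookkeeping on top of the
Landau-method bound (`hU`, the conclusion of `GaussianHecke.exists_norm_twistedSum_le` at the chosen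
`δ, T_P`), with `h = ηN`: the bracket is `≤ η²` (`hQb`), de la Vallée-Poussin
(`TwistedVonMangoldt.psi_sub_psi_le`) gives `ψ(N + ηN) - ψ(N) ≤ ηN + 3C₂N e^{-c₁√log N} ≤ 2ηN` (`hsav`),
and `1 ≤ ηX₀ ≤ ηN`. [cite: Harman2007, Lemma 11.6 (proof)] -/
theorem norm_usum_le {m : ℕ} {t η S X₀ K₀ B δ TP c₁ C₂ : ℝ} (hη0 : 0 < η) (hη1 : η ≤ 1)
    (hX₀ : 8 ≤ X₀) (hηX₀ : 1 ≤ η * X₀) (hc₁ : 0 < c₁) (hC₂ : 0 ≤ C₂)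
    (hψ : ∀ u : ℝ, 2 ≤ u → |Chebyshev.psi u - u| ≤ C₂ * u / Real.exp (c₁ * Real.sqrt (Real.log u)))
    (hU : ∀ x h : ℝ, Real.exp 2 ≤ x → 0 < h → h ≤ x →
        ‖∑ n ∈ Finset.Ioc 0 ⌊x⌋₊, lCoeff m n * (n : ℂ) ^ ((t : ℂ) * I) / 2‖ ≤
          5 * x ^ 2 * ((2 * Real.log (2 * x) + K₀) / TP + 2 * B * x ^ (1 - δ / 2 - 1) + 2 * B / TP ^ 2) / h +
            h / 2 + 1 + (Chebyshev.psi (x + h) - Chebyshev.psi x))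
    (hQb : ∀ x : ℝ, X₀ ≤ x → x ≤ S →
        (2 * Real.log (2 * x) + K₀) / TP + 2 * B * x ^ (1 - δ / 2 - 1) + 2 * B / TP ^ 2 ≤ η ^ 2)
    (hsav : ∀ x : ℝ, X₀ ≤ x → x ≤ S → 3 * C₂ * x / Real.exp (c₁ * Real.sqrt (Real.log x)) ≤ η * x)
    {N : ℕ} (hN1 : X₀ ≤ N) (hN2 : (N : ℝ) ≤ S) :
    ‖∑ n ∈ Finset.Ioc 0 N, lCoeff m n * (n : ℂ) ^ ((t : ℂ) * I) / 2‖ ≤ 9 * η * N := by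
  have hx8 : (8 : ℝ) ≤ N := hX₀.trans hN1
  have hx0 : (0 : ℝ) < N := by linarith
  have hxe : Real.exp 2 ≤ (N : ℝ) := by
    have h := Real.exp_one_lt_d9
    have h2 : Real.exp 2 = Real.exp 1 * Real.exp 1 := by rw [← Real.exp_add]; norm_num
    nlinarith [Real.exp_pos 1]
  set h : ℝ := η * N with hhdef
  have hh0 : 0 < h := mul_pos hη0 hx0
  have hhx : h ≤ N := by rw [hhdef]; nlinarith
  have hmain := hU N h hxe hh0 hhx
  rw [Nat.floor_natCast] at hmain
  -- the bracket
  have hQ := hQb N hN1 hN2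
  have h1 : 5 * (N : ℝ) ^ 2 *
      ((2 * Real.log (2 * (N : ℝ)) + K₀) / TP + 2 * B * (N : ℝ) ^ (1 - δ / 2 - 1) + 2 * B / TP ^ 2) / h ≤
      5 * η * N := by
    rw [div_le_iff₀ hh0, hhdef]
    calc 5 * (N : ℝ) ^ 2 * ((2 * Real.log (2 * (N : ℝ)) + K₀) / TP + 2 * B * (N : ℝ) ^ (1 - δ / 2 - 1) +
          2 * B / TP ^ 2) ≤ 5 * (N : ℝ) ^ 2 * η ^ 2 := by
          exact mul_le_mul_of_nonneg_left hQ (by positivity)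
      _ = 5 * η * N * (η * N) := by ring
  -- de la Vallée-Poussin
  have hψb := TwistedVonMangoldt.psi_sub_psi_le hc₁ hC₂ hψ (by linarith) (by linarith : (N : ℝ) ≤ N + h)
    (by linarith : (N : ℝ) + h ≤ 2 * N)
  have hsavN := hsav N hN1 hN2
  have hone : 1 ≤ η * N := hηX₀.trans (by nlinarith)
  have h2 : Chebyshev.psi ((N : ℝ) + h) - Chebyshev.psi N ≤ 2 * (η * N) := by
    have : (N : ℝ) + h - N = η * N := by rw [hhdef]; ring
    rw [this] at hψb
    linarith
  calc ‖∑ n ∈ Finset.Ioc 0 N, lCoeff m n * (n : ℂ) ^ ((t : ℂ) * I) / 2‖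
      ≤ 5 * (N : ℝ) ^ 2 * ((2 * Real.log (2 * (N : ℝ)) + K₀) / TP + 2 * B * (N : ℝ) ^ (1 - δ / 2 - 1) +
          2 * B / TP ^ 2) / h + h / 2 + 1 + (Chebyshev.psi ((N : ℝ) + h) - Chebyshev.psi N) := hmain
    _ ≤ 5 * η * N + η * N / 2 + η * N + 2 * (η * N) := by rw [hhdef] at h1 ⊢; linarith
    _ ≤ 9 * η * N := by nlinarith

/-- **The twisted `θ`-sums are `≤ 19ηS` up to `S`**: below `X₀ = Sη/12` trivially
(`Θ_{ℤ[i]}(N) ≤ 12N`), above it by `norm_usum_le` and the prime-power bound `13√N log²N ≤ ηN` (`hE`).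
[cite: Harman2007, Lemma 11.6 (proof)] -/
theorem norm_twTheta_le {m : ℕ} {t η S X₀ : ℝ} (hη0 : 0 < η) (hX₀ : 8 ≤ X₀) (hX₀def : X₀ = S * η / 12)
    (hUsum : ∀ N : ℕ, X₀ ≤ N → (N : ℝ) ≤ S →
      ‖∑ n ∈ Finset.Ioc 0 N, lCoeff m n * (n : ℂ) ^ ((t : ℂ) * I) / 2‖ ≤ 9 * η * N)
    (hE : ∀ N : ℕ, X₀ ≤ N → (N : ℝ) ≤ S → 13 * Real.sqrt N * Real.log N ^ 2 ≤ η * N)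
    (N : ℕ) (hN : (N : ℝ) ≤ S) :
    ‖∑ π ∈ primesQ1 N, (Real.log (π.norm : ℝ) : ℂ) * angularChar m π *
        ((π.norm.natAbs : ℕ) : ℂ) ^ ((t : ℂ) * I)‖ ≤ 19 * η * S := by
  have hS0 : 0 < S := by
    have : 0 < S * η / 12 := by rw [← hX₀def]; linarith
    nlinarith
  have hf : ∀ n : ℕ, ‖((n : ℂ)) ^ ((t : ℂ) * I)‖ ≤ 1 := by
    intro n
    rcases Nat.eq_zero_or_pos n with rfl | hn
    · simp only [Nat.cast_zero]
      rcases eq_or_ne ((t : ℂ) * I) 0 with h0 | h0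
      · rw [h0, cpow_zero, norm_one]
      · rw [zero_cpow h0, norm_zero]; exact zero_le_one
    · rw [Complex.norm_natCast_cpow_of_pos hn]; simp
  rcases lt_or_ge (N : ℝ) X₀ with hlt | hge
  · -- trivial range
    calc ‖∑ π ∈ primesQ1 N, (Real.log (π.norm : ℝ) : ℂ) * angularChar m π *
          ((π.norm.natAbs : ℕ) : ℂ) ^ ((t : ℂ) * I)‖
        ≤ thetaReal N := norm_primeSum_le_thetaReal m N (fun n ↦ (n : ℂ) ^ ((t : ℂ) * I)) hf
      _ ≤ 12 * N := thetaReal_le N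
      _ ≤ 12 * X₀ := by linarith
      _ = η * S := by rw [hX₀def]; ring
      _ ≤ 19 * η * S := by nlinarith
  · -- analytic range
    have hN1 : 1 ≤ N := by
      have : (1 : ℝ) ≤ N := by linarith
      exact_mod_cast this
    have hpp := norm_sum_lCoeff_mul_sub_primeSum_le m hN1 (fun n ↦ (n : ℂ) ^ ((t : ℂ) * I)) hf
    have h13 := (hpp.trans (nine_sqrt_log_le N)).trans (hE N hge hN)
    have hU := hUsum N hge hN
    have hIcc : ∑ n ∈ Icc 1 N, lCoeff m n * (n : ℂ) ^ ((t : ℂ) * I) =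
        2 * ∑ n ∈ Finset.Ioc 0 N, lCoeff m n * (n : ℂ) ^ ((t : ℂ) * I) / 2 := by
      rw [mul_sum, show Icc 1 N = Finset.Ioc 0 N from rfl]
      refine sum_congr rfl fun n _ ↦ ?_
      ring
    rw [hIcc] at h13
    have hxN : (N : ℝ) ≤ S := hN
    calc ‖∑ π ∈ primesQ1 N, (Real.log (π.norm : ℝ) : ℂ) * angularChar m π *
          ((π.norm.natAbs : ℕ) : ℂ) ^ ((t : ℂ) * I)‖
        ≤ ‖2 * ∑ n ∈ Finset.Ioc 0 N, lCoeff m n * (n : ℂ) ^ ((t : ℂ) * I) / 2‖ + η * N := by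
          set Uu := 2 * ∑ n ∈ Finset.Ioc 0 N, lCoeff m n * (n : ℂ) ^ ((t : ℂ) * I) / 2 with hUu
          set Θ := ∑ π ∈ primesQ1 N, (Real.log (π.norm : ℝ) : ℂ) * angularChar m π *
              ((π.norm.natAbs : ℕ) : ℂ) ^ ((t : ℂ) * I) with hΘ
          calc ‖Θ‖ = ‖Uu - (Uu - Θ)‖ := by rw [sub_sub_cancel]
            _ ≤ ‖Uu‖ + ‖Uu - Θ‖ := norm_sub_le _ _
            _ ≤ ‖Uu‖ + η * N := by linarith [h13]
      _ ≤ 2 * (9 * η * N) + η * N := by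
          rw [norm_mul, Complex.norm_ofNat]; linarith
      _ = 19 * η * N := by ring
      _ ≤ 19 * η * S := by nlinarith

/-! ### Removing the weights `log N(p)` -/

/-- **From the twisted `θ`-sums to Harman's sum**: if `‖∑_{N(π) ≤ N} log N(π) λ^m(π) N(π)^{it}‖ ≤ M` for
all `N ≤ S`, then `‖∑_{R ≤ N(p) < S} N(p)^{it} λ^m(p)‖ ≤ 3M` (`R ≥ 2`; Abel summation with the weights
`1/log n`, `2M/log ⌈R⌉ ≤ 2M/log 2 ≤ 3M`). [cite: Harman2007, Lemma 11.6 (proof)] -/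
theorem norm_primeCharSum_le_of_theta {R S M : ℝ} (hR : 2 ≤ R) (hS : 0 < S) (m : ℕ) (t : ℝ) (hM : 0 ≤ M)
    (hΘ : ∀ N : ℕ, (N : ℝ) ≤ S → ‖∑ π ∈ primesQ1 N, (Real.log (π.norm : ℝ) : ℂ) * angularChar m π *
        ((π.norm.natAbs : ℕ) : ℂ) ^ ((t : ℂ) * I)‖ ≤ M) :
    ‖GaussianInt.primeCharSum R S m t‖ ≤ 3 * M := by
  rw [primeCharSum_eq_sum_Icc hR hS m t]
  set N₁ : ℕ := ⌈R⌉₊ with hN₁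
  set N₂ : ℕ := ⌈S⌉₊ - 1 with hN₂
  have hR2 : (2 : ℝ) ≤ (N₁ : ℕ) := hR.trans (Nat.le_ceil R)
  have hN₁2 : 2 ≤ N₁ := by exact_mod_cast hR2
  have hN₂S : (N₂ : ℝ) ≤ S := by
    have h1 : (⌈S⌉₊ : ℝ) < S + 1 := Nat.ceil_lt_add_one hS.le
    rcases Nat.eq_zero_or_pos ⌈S⌉₊ with h0 | hpos
    · rw [hN₂, h0]; simp; exact hS.le
    · have : ((⌈S⌉₊ - 1 : ℕ) : ℝ) = ⌈S⌉₊ - 1 := by rw [Nat.cast_sub hpos]; simp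
      rw [hN₂, this]; linarith
  rcases lt_or_ge N₂ N₁ with hlt | hle
  · rw [Finset.Icc_eq_empty_of_lt hlt, sum_empty, norm_zero]; positivity
  -- Abel summation
  have hlog2 : (2 : ℝ) / 3 < Real.log 2 := by have := Real.log_two_gt_d9; linarith
  have key := norm_sum_Icc_mul_le_of_antitone (a := fun n ↦ ∑ π ∈ (primesQ1 n).filter
      (fun π ↦ π.norm.natAbs = n), (Real.log (π.norm : ℝ) : ℂ) * angularChar m π *
        ((π.norm.natAbs : ℕ) : ℂ) ^ ((t : ℂ) * I))
    (w := fun n ↦ (Real.log n)⁻¹) (N₁ := N₁) (N₂ := N₂) (M := M) (by omega) hle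
    (fun i hi _ ↦ by
      have hi2 : (2 : ℝ) ≤ (i : ℝ) := by exact_mod_cast hN₁2.trans hi
      have hli : 0 < Real.log (i : ℝ) := Real.log_pos (by linarith)
      exact inv_anti₀ hli (Real.log_le_log (by linarith) (by push_cast; linarith)))
    (by
      have : (1 : ℝ) ≤ N₂ := by exact_mod_cast (le_trans (by omega : 1 ≤ N₁) hle)
      exact inv_nonneg.mpr (Real.log_nonneg this))
    (fun k hk1 hk2 ↦ by
      rw [sum_range_fiber_eq_primeSum m (fun n ↦ (n : ℂ) ^ ((t : ℂ) * I)) k]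
      refine hΘ (k - 1) ?_
      have : ((k - 1 : ℕ) : ℝ) ≤ N₂ := by exact_mod_cast (by omega : k - 1 ≤ N₂)
      exact this.trans hN₂S)
  refine key.trans ?_
  -- `2 M / log N₁ ≤ 3 M`
  have hlogN₁ : Real.log 2 ≤ Real.log N₁ := Real.log_le_log (by norm_num) hR2
  have hl0 : 0 < Real.log (N₁ : ℝ) := lt_of_lt_of_le (by linarith) hlogN₁
  have hinv : (Real.log (N₁ : ℝ))⁻¹ ≤ 3 / 2 := by
    rw [inv_le_comm₀ hl0 (by norm_num)]
    linarith
  calc 2 * M * (Real.log (N₁ : ℝ))⁻¹ ≤ 2 * M * (3 / 2) := by gcongr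
    _ = 3 * M := by ring


/-! ### Numerical facts -/

/-- `log 12 ≤ 3` and `log 96 ≤ 5` (`e³ > 20`, `e⁵ > 148`). [folklore] -/
theorem log_twelve_le : Real.log 12 ≤ 3 ∧ Real.log 96 ≤ 5 := by
  have he := Real.exp_one_gt_d9
  have h27 : (2.7 : ℝ) ≤ Real.exp 1 := by linarith
  have h3 : Real.exp 3 = Real.exp 1 ^ 3 := by rw [← Real.exp_nat_mul]; norm_num
  have h5 : Real.exp 5 = Real.exp 1 ^ 5 := by rw [← Real.exp_nat_mul]; norm_num
  have p3 := pow_le_pow_left₀ (by norm_num : (0 : ℝ) ≤ 2.7) h27 3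
  have p5 := pow_le_pow_left₀ (by norm_num : (0 : ℝ) ≤ 2.7) h27 5
  norm_num at p3 p5
  constructor
  · rw [Real.log_le_iff_le_exp (by norm_num), h3]; linarith
  · rw [Real.log_le_iff_le_exp (by norm_num), h5]; linarith

/-- `Q² + a + 2b + 6 ≤ Q⁴` for `Q ≥ 4`, `a ≤ Q - 1`, `b ≤ Q` (the Landau height against `(TU)⁴`).
[folklore] -/
theorem height_le_pow_four {Q a b : ℝ} (hQ : 4 ≤ Q) (haQ : a + 1 ≤ Q) (hbQ : b ≤ Q) :
    Q ^ 2 + a + 2 * b + 6 ≤ Q ^ 4 := by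
  nlinarith [sq_nonneg Q, mul_self_nonneg (Q - 4)]

/-- The prime-power bound in the analytic range: `13 √x log²x ≤ ηx` once `log x ≤ ℓ` and
`(48ℓ²)²/12 ≤ η² X₀ ≤ η² x`. [folklore] -/
theorem sqrt_mul_log_sq_le {ℓ η X₀ x : ℝ} (hx : 0 < x) (hX₀x : X₀ ≤ x) (hlog : Real.log x ≤ ℓ)
    (hlog0 : 0 ≤ Real.log x) (hη : 0 ≤ η) (hkey : (48 * ℓ ^ 2) ^ 2 / 12 ≤ η ^ 2 * X₀) :
    13 * Real.sqrt x * Real.log x ^ 2 ≤ η * x := by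
  have h1 : (13 * ℓ ^ 2) ^ 2 ≤ (η * Real.sqrt x) ^ 2 := by
    have h2 : (η * Real.sqrt x) ^ 2 = η ^ 2 * x := by rw [mul_pow, Real.sq_sqrt hx.le]
    have h3 : η ^ 2 * X₀ ≤ η ^ 2 * x := mul_le_mul_of_nonneg_left hX₀x (sq_nonneg η)
    have h4 : (13 * ℓ ^ 2) ^ 2 ≤ (48 * ℓ ^ 2) ^ 2 / 12 := by nlinarith [sq_nonneg (ℓ ^ 2)]
    rw [h2]; linarith
  have h5 : 13 * ℓ ^ 2 ≤ η * Real.sqrt x :=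
    (pow_le_pow_iff_left₀ (by positivity) (by positivity) two_ne_zero).mp h1
  have h6 : Real.log x ^ 2 ≤ ℓ ^ 2 := pow_le_pow_left₀ hlog0 hlog 2
  calc 13 * Real.sqrt x * Real.log x ^ 2 ≤ 13 * Real.sqrt x * ℓ ^ 2 := by gcongr
    _ = 13 * ℓ ^ 2 * Real.sqrt x := by ring
    _ ≤ η * Real.sqrt x * Real.sqrt x := mul_le_mul_of_nonneg_right h5 (Real.sqrt_nonneg _)
    _ = η * x := by rw [mul_assoc, Real.mul_self_sqrt hx.le]

end GaussianHecke

/-! ### The conditional proof of Harman's Lemma 11.6 -/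

namespace GaussianInt

open GaussianHecke

set_option maxHeartbeats 1600000 in
/-- **Harman, *Prime-Detecting Sieves*, Lemma 11.6, from a Coleman-type zero-free region.**  Assume
`GaussianHecke.HasVKZeroFreeRegion c V₀` for some `c > 0` (Coleman 1990, Thm 2, for `ℚ(i)` gives this).
Then there is an absolute `C` such that for `R, U ≥ 2`, `T ≥ S ≥ R + exp((log UT)^{4/5})`, `1 ≤ m ≤ T`,
`|t| ≤ U`: `‖∑_{R ≤ N(p) < S} N(p)^{it} λ^m(p)‖ ≤ C S exp(-log S/(2 (log TU)^{7/10}))`, i.e. the named fact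
`Literature.NumberTheory.LFunctions.GaussianInt.harman_primeCharSum_bound` holds.
[cite: Harman2007, Lemma 11.6] [cite: ColemanMathematika1990, Theorem 2] -/
theorem harman_primeCharSum_bound_of_vk {c V₀ : ℝ} (hc : 0 < c)
    (hVK : GaussianHecke.HasVKZeroFreeRegion c V₀) : harman_primeCharSum_bound := by
  -- absolute constants
  obtain ⟨K₀, C₁, hK₀, hC₁, hU⟩ := exists_norm_twistedSum_le
  obtain ⟨c₁, hc₁, C₂, hψ⟩ := ChebyshevPsiDeLaValleePoussin_holds
  set C₂' : ℝ := max C₂ 1 with hC₂'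
  have hC₂'1 : 1 ≤ C₂' := le_max_right _ _
  have hC₂'0 : 0 ≤ C₂' := le_trans zero_le_one hC₂'1
  have hψ' : ∀ u : ℝ, 2 ≤ u →
      |Chebyshev.psi u - u| ≤ C₂' * u / Real.exp (c₁ * Real.sqrt (Real.log u)) := by
    intro u hu
    refine (hψ u hu).trans ?_
    rw [mul_div_assoc, mul_div_assoc]
    exact mul_le_mul_of_nonneg_right (le_max_left _ _) (by positivity)
  -- the good scales `ℓ = log TU`
  have hgood : ∀ᶠ ℓ : ℝ in atTop,
      205 ≤ ℓ ^ (7 / 10 : ℝ) ∧ 10 ≤ ℓ ^ (4 / 5 : ℝ) ∧ 1 ≤ ℓ ∧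
      (∀ (m : ℕ), 1 ≤ m → (m : ℝ) ≤ Real.exp ℓ → ∀ z : ℂ, |z.im| ≤ 2 * Real.exp ℓ ^ 2 →
        1 - c / (Real.log (4 * Real.exp ℓ ^ 2) ^ (2 / 3 : ℝ) *
          Real.log (Real.log (4 * Real.exp ℓ ^ 2)) ^ (1 / 3 : ℝ)) ≤ z.re → heckeL m z ≠ 0) ∧
      16 * (Real.log (4 * Real.exp ℓ ^ 2) ^ (2 / 3 : ℝ) *
          Real.log (Real.log (4 * Real.exp ℓ ^ 2)) ^ (1 / 3 : ℝ)) ≤ c * ℓ ^ (7 / 10 : ℝ) ∧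
      3 * (2 * ℓ + 2 + K₀) ≤ Real.exp ℓ ∧
      3 * C₁ * ℓ ^ (27 / 10 : ℝ) ≤ Real.exp (3 * ℓ ^ (1 / 10 : ℝ)) ∧
      (∀ σ : ℝ, ℓ ^ (4 / 5 : ℝ) ≤ σ → σ ≤ ℓ →
        Real.log (3 * C₂') ≤ c₁ * Real.sqrt (σ / 2) - σ / (2 * ℓ ^ (7 / 10 : ℝ))) ∧
      48 * ℓ ^ (2 : ℝ) ≤ Real.exp (1 / 4 * ℓ ^ (4 / 5 : ℝ)) := by
    have h6 : ∀ᶠ ℓ : ℝ in atTop, 3 * (2 * ℓ + 2 + K₀) ≤ Real.exp ℓ := by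
      filter_upwards [TwistedVonMangoldt.eventually_mul_rpow_le_exp (12 + 3 * K₀) 1 one_pos one_pos,
        eventually_ge_atTop (1 : ℝ)] with ℓ h hℓ
      simp only [Real.rpow_one, one_mul] at h
      nlinarith
    filter_upwards [(tendsto_rpow_atTop (by norm_num : (0 : ℝ) < 7 / 10)).eventually_ge_atTop (205 : ℝ),
      (tendsto_rpow_atTop (by norm_num : (0 : ℝ) < 4 / 5)).eventually_ge_atTop (10 : ℝ),
      eventually_ge_atTop (1 : ℝ), Real.tendsto_exp_atTop.eventually (eventually_zeroFree_of_vk hc hVK),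
      eventually_vkDen_le hc, h6,
      TwistedVonMangoldt.eventually_mul_rpow_le_exp (3 * C₁) (27 / 10) (by norm_num : (0 : ℝ) < 3)
        (by norm_num : (0 : ℝ) < 1 / 10),
      eventually_dlVP_saving hc₁ (Real.log (3 * C₂')),
      TwistedVonMangoldt.eventually_mul_rpow_le_exp 48 2 (by norm_num : (0 : ℝ) < 1 / 4)
        (by norm_num : (0 : ℝ) < 4 / 5)] with ℓ a1 a2 a3 a4 a5 a6 a7 a8 a9
    exact ⟨a1, a2, a3, a4, a5, a6, a7, a8, a9⟩
  obtain ⟨ℓ₀, hℓ₀⟩ := Filter.eventually_atTop.mp hgood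
  -- the constant: `57` on good scales, `9 e^{ℓ₁^{3/10}/2}` (`ℓ₁ = max ℓ₀ 1`) on the bounded range
  set ℓ₁ : ℝ := max ℓ₀ 1 with hℓ₁
  have hℓ₁0 : 0 < ℓ₁ := lt_of_lt_of_le one_pos (le_max_right _ _)
  set Cbad : ℝ := 9 * Real.exp (ℓ₁ ^ (3 / 10 : ℝ) / 2) with hCbad
  have hCbad0 : 0 ≤ Cbad := by positivity
  refine ⟨57 + Cbad, fun R U S T t m hR hU2 hRS hST hm1 hmT htU ↦ ?_⟩
  -- basic sizes
  have hexp0 : 0 < Real.exp (Real.log (U * T) ^ (4 / 5 : ℝ)) := Real.exp_pos _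
  have hS2 : 2 < S := by linarith
  have hS0 : 0 < S := by linarith
  have hS1 : 1 ≤ S := by linarith
  have hT0 : 0 < T := by linarith
  have hU0 : 0 < U := by linarith
  have hQ0 : 0 < T * U := mul_pos hT0 hU0
  have hℓ_def : Real.log (U * T) = Real.log (T * U) := by rw [mul_comm]
  -- notation-free abbreviations through `obtain`
  obtain ⟨ℓ, hℓ⟩ : ∃ ℓ : ℝ, ℓ = Real.log (T * U) := ⟨_, rfl⟩
  obtain ⟨σ, hσ⟩ : ∃ σ : ℝ, σ = Real.log S := ⟨_, rfl⟩
  obtain ⟨η, hη⟩ : ∃ η : ℝ, η = Real.exp (-(σ / (2 * ℓ ^ (7 / 10 : ℝ)))) := ⟨_, rfl⟩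
  rw [← hσ, ← hℓ, ← hη]
  have hexpℓ : Real.exp ℓ = T * U := by rw [hℓ, Real.exp_log hQ0]
  have hexpσ : Real.exp σ = S := by rw [hσ, Real.exp_log hS0]
  have hη0 : 0 < η := by rw [hη]; exact Real.exp_pos _
  have hQS : 2 * S ≤ T * U := by
    calc 2 * S ≤ 2 * T := by linarith
      _ ≤ U * T := mul_le_mul_of_nonneg_right hU2 hT0.le
      _ = T * U := mul_comm _ _
  have hQ4 : 4 < T * U := by linarith
  have hTQ : T ≤ T * U := le_mul_of_one_le_right hT0.le (by linarith)
  have hUQ : U + 1 ≤ T * U := by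
    calc U + 1 ≤ 2 * U := by linarith
      _ ≤ T * U := mul_le_mul_of_nonneg_right (by linarith) hU0.le
  have hℓpos : 0 < ℓ := by
    rw [hℓ]; exact Real.log_pos (by linarith)
  have hℓ7pos : 0 < ℓ ^ (7 / 10 : ℝ) := Real.rpow_pos_of_pos hℓpos _
  have hσℓ : σ ≤ ℓ := by rw [hσ, hℓ]; exact Real.log_le_log hS0 (by linarith)
  have hσlow : ℓ ^ (4 / 5 : ℝ) ≤ σ := by
    rw [hσ, Real.le_log_iff_exp_le hS0, hℓ, ← hℓ_def]
    linarith
  have hσ0 : 0 < σ := lt_of_lt_of_le (Real.rpow_pos_of_pos hℓpos _) hσlow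
  have hη1 : η ≤ 1 := by
    rw [hη, Real.exp_le_one_iff, neg_nonpos]; positivity
  have hηsq : η ^ 2 = Real.exp (-(σ / ℓ ^ (7 / 10 : ℝ))) := by
    rw [hη, ← Real.exp_nat_mul]; congr 1; push_cast; ring
  by_cases hcase : ℓ₀ ≤ ℓ
  · ------------------------------------------------------------------ good scales
    obtain ⟨g1, g2, g3, g4, g5, g6, g7, g8, g9⟩ := hℓ₀ ℓ hcase
    obtain ⟨hlog12, hlog96⟩ := log_twelve_le
    have hσ10 : 10 ≤ σ := g2.trans hσlow
    -- `δ = 16 ℓ^{-7/10}` and the Perron height `(TU)²`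
    obtain ⟨δ, hδ⟩ : ∃ δ : ℝ, δ = 16 / ℓ ^ (7 / 10 : ℝ) := ⟨_, rfl⟩
    have hδ0 : 0 < δ := by rw [hδ]; positivity
    have hδ1 : δ ≤ 5 / 64 := by
      rw [hδ, div_le_iff₀ hℓ7pos]; linarith
    have hδℓ : δ * ℓ ^ (7 / 10 : ℝ) = 16 := by rw [hδ]; field_simp
    obtain ⟨TP, hTP⟩ : ∃ TP : ℝ, TP = (T * U) ^ 2 := ⟨_, rfl⟩
    have hTP1 : 1 ≤ TP := by rw [hTP]; exact one_le_pow₀ (by linarith)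
    have hTP0 : 0 < TP := by linarith
    have hTPexp : TP = Real.exp ℓ ^ 2 := by rw [hTP, hexpℓ]
    -- the zero-free box at this scale
    have hV : Real.exp 1 < 4 * Real.exp ℓ ^ 2 := by
      have h1 : Real.exp 1 ≤ Real.exp ℓ := Real.exp_le_exp.mpr g3
      have h2 : 1 ≤ Real.exp ℓ := Real.one_le_exp hℓpos.le
      nlinarith
    have hgpos := vkDen_pos hV
    have hδvk : δ ≤ c / (Real.log (4 * Real.exp ℓ ^ 2) ^ (2 / 3 : ℝ) *
        Real.log (Real.log (4 * Real.exp ℓ ^ 2)) ^ (1 / 3 : ℝ)) := by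
      rw [le_div_iff₀ hgpos, hδ]
      calc 16 / ℓ ^ (7 / 10 : ℝ) * (Real.log (4 * Real.exp ℓ ^ 2) ^ (2 / 3 : ℝ) *
            Real.log (Real.log (4 * Real.exp ℓ ^ 2)) ^ (1 / 3 : ℝ))
          = 16 * (Real.log (4 * Real.exp ℓ ^ 2) ^ (2 / 3 : ℝ) *
            Real.log (Real.log (4 * Real.exp ℓ ^ 2)) ^ (1 / 3 : ℝ)) / ℓ ^ (7 / 10 : ℝ) := by ring
        _ ≤ c * ℓ ^ (7 / 10 : ℝ) / ℓ ^ (7 / 10 : ℝ) := div_le_div_of_nonneg_right g5 hℓ7pos.le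
        _ = c := by field_simp
    have hzf : ∀ z : ℂ, 1 - δ ≤ z.re → |z.im| ≤ TP + |t| + 1 → heckeL m z ≠ 0 := by
      intro z hz hzi
      refine g4 m hm1 (by rw [hexpℓ]; exact hmT.trans hTQ) z ?_ (by linarith)
      rw [hTPexp] at hzi
      have : |t| + 1 ≤ Real.exp ℓ ^ 2 := by
        rw [hexpℓ]
        calc |t| + 1 ≤ T * U := by linarith
          _ ≤ (T * U) ^ 2 := le_self_pow₀ (by linarith) two_ne_zero
      linarith
    have hm0 : m ≠ 0 := by omega
    have hUx := hU m hm0 t δ TP hδ0 hδ1 hTP1 hzf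
    -- the threshold `X₀ = Sη/12`
    obtain ⟨X₀, hX₀⟩ : ∃ X₀ : ℝ, X₀ = S * η / 12 := ⟨_, rfl⟩
    have hℓ73 : 3 ≤ ℓ ^ (7 / 10 : ℝ) := by linarith
    have hσfrac : σ / ℓ ^ (7 / 10 : ℝ) ≤ σ / 3 := div_le_div_of_nonneg_left hσ0.le (by norm_num) hℓ73
    have hσfrac0 : 0 ≤ σ / ℓ ^ (7 / 10 : ℝ) := by positivity
    have hX₀exp : X₀ = Real.exp (σ - σ / (2 * ℓ ^ (7 / 10 : ℝ))) / 12 := by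
      rw [hX₀, sub_eq_add_neg, Real.exp_add, hexpσ, ← hη]
    have hX₀8 : 8 ≤ X₀ := by
      rw [hX₀exp, le_div_iff₀ (by norm_num)]
      have h1 : (96 : ℝ) ≤ Real.exp (σ - σ / (2 * ℓ ^ (7 / 10 : ℝ))) := by
        rw [← Real.exp_log (by norm_num : (0 : ℝ) < 96)]
        apply Real.exp_le_exp.mpr
        have : σ / (2 * ℓ ^ (7 / 10 : ℝ)) = (σ / ℓ ^ (7 / 10 : ℝ)) / 2 := by ring
        rw [this]; linarith
      linarith
    have hX₀0 : 0 < X₀ := by linarith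
    have hηX₀ : 1 ≤ η * X₀ := by
      have h1 : η * X₀ = Real.exp (σ - σ / ℓ ^ (7 / 10 : ℝ)) / 12 := by
        rw [hX₀, show η * (S * η / 12) = S * η ^ 2 / 12 by ring, hηsq, ← hexpσ, ← Real.exp_add]
        ring_nf
      rw [h1, le_div_iff₀ (by norm_num)]
      have : (12 : ℝ) ≤ Real.exp (σ - σ / ℓ ^ (7 / 10 : ℝ)) := by
        rw [← Real.exp_log (by norm_num : (0 : ℝ) < 12)]
        exact Real.exp_le_exp.mpr (by linarith)
      linarith
    -- `log x ≥ σ/2` on `[X₀, S]`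
    have hlogx : ∀ x : ℝ, X₀ ≤ x → σ / 2 ≤ Real.log x := by
      intro x hx
      have h1 : Real.log X₀ ≤ Real.log x := Real.log_le_log hX₀0 hx
      have h2 : Real.log X₀ = σ - σ / (2 * ℓ ^ (7 / 10 : ℝ)) - Real.log 12 := by
        rw [hX₀exp, Real.log_div (Real.exp_pos _).ne' (by norm_num), Real.log_exp]
      have : σ / (2 * ℓ ^ (7 / 10 : ℝ)) = (σ / ℓ ^ (7 / 10 : ℝ)) / 2 := by ring
      rw [h2, this] at h1
      linarith
    have hlogxS : ∀ x : ℝ, 0 < x → x ≤ S → Real.log x ≤ σ := fun x hx hxS ↦ by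
      rw [hσ]; exact Real.log_le_log hx hxS
    -- the bracket is `≤ η²`
    have hBbar : C₁ * Real.log (TP + |t| + 2 * m + 6) ^ 2 / δ / 2 ≤ C₁ * ℓ ^ (27 / 10 : ℝ) / 2 := by
      have harg : TP + |t| + 2 * m + 6 ≤ (T * U) ^ 4 := by
        rw [hTP]
        exact height_le_pow_four hQ4.le (by linarith) (hmT.trans hTQ)
      have harg0 : 1 < TP + |t| + 2 * m + 6 := by have := abs_nonneg t; linarith
      have hlog4 : Real.log (TP + |t| + 2 * m + 6) ≤ 4 * ℓ := by
        calc Real.log (TP + |t| + 2 * m + 6) ≤ Real.log ((T * U) ^ 4) := Real.log_le_log (by linarith) harg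
          _ = 4 * ℓ := by rw [Real.log_pow, hℓ]; push_cast; ring
      have hlog0 : 0 ≤ Real.log (TP + |t| + 2 * m + 6) := Real.log_nonneg harg0.le
      have hsq : Real.log (TP + |t| + 2 * m + 6) ^ 2 ≤ 16 * ℓ ^ 2 := by
        calc Real.log (TP + |t| + 2 * m + 6) ^ 2 ≤ (4 * ℓ) ^ 2 := pow_le_pow_left₀ hlog0 hlog4 2
          _ = 16 * ℓ ^ 2 := by ring
      have hpow : ℓ ^ (27 / 10 : ℝ) = ℓ ^ 2 * ℓ ^ (7 / 10 : ℝ) := by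
        rw [← Real.rpow_natCast, ← Real.rpow_add hℓpos]; norm_num
      rw [hpow, hδ, div_div_eq_mul_div]
      apply div_le_div_of_nonneg_right _ (by norm_num : (0 : ℝ) ≤ 2)
      rw [div_le_iff₀ (by norm_num : (0 : ℝ) < 16)]
      calc C₁ * Real.log (TP + |t| + 2 * ↑m + 6) ^ 2 * ℓ ^ (7 / 10 : ℝ)
          ≤ C₁ * (16 * ℓ ^ 2) * ℓ ^ (7 / 10 : ℝ) := by gcongr
        _ = C₁ * (ℓ ^ 2 * ℓ ^ (7 / 10 : ℝ)) * 16 := by ring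
    set B : ℝ := C₁ * Real.log (TP + |t| + 2 * m + 6) ^ 2 / δ / 2 with hBdef
    have hB0 : 0 ≤ B := by positivity
    have h2B : 2 * B ≤ Real.exp (3 * ℓ ^ (1 / 10 : ℝ)) / 3 := by
      have : 2 * B ≤ C₁ * ℓ ^ (27 / 10 : ℝ) := by linarith
      linarith
    have hexpℓη : Real.exp (-ℓ) ≤ η ^ 2 := by
      rw [hηsq]; apply Real.exp_le_exp.mpr
      have : σ / ℓ ^ (7 / 10 : ℝ) ≤ σ / 1 := div_le_div_of_nonneg_left hσ0.le one_pos (by linarith)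
      rw [div_one] at this; linarith
    have hQb : ∀ x : ℝ, X₀ ≤ x → x ≤ S →
        (2 * Real.log (2 * x) + K₀) / TP + 2 * B * x ^ (1 - δ / 2 - 1) + 2 * B / TP ^ 2 ≤ η ^ 2 := by
      intro x hx hxS
      have hx0 : 0 < x := by linarith
      -- Term 1
      have hT1 : (2 * Real.log (2 * x) + K₀) / TP ≤ η ^ 2 / 3 := by
        have hlog2x : Real.log (2 * x) ≤ ℓ := by
          rw [hℓ]; exact Real.log_le_log (by linarith) (by linarith)
        have hnum : 2 * Real.log (2 * x) + K₀ ≤ Real.exp ℓ / 3 := by linarith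
        have hid : Real.exp ℓ / 3 / Real.exp ℓ ^ 2 = Real.exp (-ℓ) / 3 := by
          rw [Real.exp_neg]; have hne := (Real.exp_pos ℓ).ne'; field_simp
        calc (2 * Real.log (2 * x) + K₀) / TP ≤ Real.exp ℓ / 3 / TP := div_le_div_of_nonneg_right hnum hTP0.le
          _ = Real.exp (-ℓ) / 3 := by rw [hTPexp, hid]
          _ ≤ η ^ 2 / 3 := by linarith [hexpℓη]
      -- Term 2
      have hT2 : 2 * B * x ^ (1 - δ / 2 - 1) ≤ η ^ 2 / 3 := by
        have hexp1 : x ^ (1 - δ / 2 - 1) ≤ Real.exp (-(4 * (σ / ℓ ^ (7 / 10 : ℝ)))) := by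
          rw [Real.rpow_def_of_pos hx0]
          apply Real.exp_le_exp.mpr
          have h1 := hlogx x hx
          have h2 : Real.log x * (1 - δ / 2 - 1) = -(δ / 2 * Real.log x) := by ring
          rw [h2, neg_le_neg_iff]
          have h3 : 4 * (σ / ℓ ^ (7 / 10 : ℝ)) = δ / 2 * (σ / 2) := by
            rw [hδ]; field_simp; ring
          rw [h3]
          exact mul_le_mul_of_nonneg_left h1 (by positivity)
        have hexp2 : Real.exp (3 * ℓ ^ (1 / 10 : ℝ)) ≤ Real.exp (3 * (σ / ℓ ^ (7 / 10 : ℝ))) := by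
          apply Real.exp_le_exp.mpr
          have : ℓ ^ (1 / 10 : ℝ) ≤ σ / ℓ ^ (7 / 10 : ℝ) := by
            rw [le_div_iff₀ hℓ7pos, ← Real.rpow_add hℓpos]; norm_num; exact hσlow
          linarith
        calc 2 * B * x ^ (1 - δ / 2 - 1) ≤ Real.exp (3 * ℓ ^ (1 / 10 : ℝ)) / 3 *
            Real.exp (-(4 * (σ / ℓ ^ (7 / 10 : ℝ)))) :=
              mul_le_mul h2B hexp1 (Real.rpow_nonneg hx0.le _) (by positivity)
          _ ≤ Real.exp (3 * (σ / ℓ ^ (7 / 10 : ℝ))) / 3 * Real.exp (-(4 * (σ / ℓ ^ (7 / 10 : ℝ)))) := by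
              gcongr
          _ = η ^ 2 / 3 := by
              rw [hηsq, div_mul_eq_mul_div, ← Real.exp_add]; congr 2; ring
      -- Term 3
      have hT3 : 2 * B / TP ^ 2 ≤ η ^ 2 / 3 := by
        have hexp3 : Real.exp (3 * ℓ ^ (1 / 10 : ℝ)) ≤ Real.exp (3 * ℓ) := by
          apply Real.exp_le_exp.mpr
          have : ℓ ^ (1 / 10 : ℝ) ≤ ℓ ^ (1 : ℝ) := Real.rpow_le_rpow_of_exponent_le g3 (by norm_num)
          rw [Real.rpow_one] at this; linarith
        have hid : Real.exp (3 * ℓ) / 3 / (Real.exp ℓ ^ 2) ^ 2 = Real.exp (-ℓ) / 3 := by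
          have h4 : (Real.exp ℓ ^ 2) ^ 2 = Real.exp (3 * ℓ) * Real.exp ℓ := by
            rw [← pow_mul, ← Real.exp_nat_mul, ← Real.exp_add]; norm_num; ring_nf
          rw [h4, Real.exp_neg]
          have hne := (Real.exp_pos ℓ).ne'
          have hne3 := (Real.exp_pos (3 * ℓ)).ne'
          field_simp
        calc 2 * B / TP ^ 2 ≤ Real.exp (3 * ℓ) / 3 / TP ^ 2 :=
            div_le_div_of_nonneg_right (h2B.trans (div_le_div_of_nonneg_right hexp3 (by norm_num)))
              (by positivity)
          _ = Real.exp (-ℓ) / 3 := by rw [hTPexp, hid]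
          _ ≤ η ^ 2 / 3 := by linarith [hexpℓη]
      linarith
    -- the de la Vallée-Poussin saving
    have hsav : ∀ x : ℝ, X₀ ≤ x → x ≤ S →
        3 * C₂' * x / Real.exp (c₁ * Real.sqrt (Real.log x)) ≤ η * x := by
      intro x hx hxS
      have hx0 : 0 < x := by linarith
      have h1 := g8 σ hσlow hσℓ
      have h2 : Real.sqrt (σ / 2) ≤ Real.sqrt (Real.log x) := Real.sqrt_le_sqrt (hlogx x hx)
      have h3 : Real.log (3 * C₂') ≤ c₁ * Real.sqrt (Real.log x) + -(σ / (2 * ℓ ^ (7 / 10 : ℝ))) := by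
        nlinarith
      have h4 : 3 * C₂' ≤ Real.exp (c₁ * Real.sqrt (Real.log x)) * η := by
        rw [hη, ← Real.exp_add, ← Real.exp_log (by positivity : 0 < 3 * C₂')]
        exact Real.exp_le_exp.mpr h3
      rw [div_le_iff₀ (Real.exp_pos _)]
      calc 3 * C₂' * x = (3 * C₂') * x := by ring
        _ ≤ (Real.exp (c₁ * Real.sqrt (Real.log x)) * η) * x := mul_le_mul_of_nonneg_right h4 hx0.le
        _ = η * x * Real.exp (c₁ * Real.sqrt (Real.log x)) := by ring
    -- prime powers
    have hkey : (48 * ℓ ^ 2) ^ 2 / 12 ≤ η ^ 2 * X₀ := by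
      have h3 : η ^ 2 * X₀ = Real.exp (σ - 3 * (σ / (2 * ℓ ^ (7 / 10 : ℝ)))) / 12 := by
        rw [hX₀, show η ^ 2 * (S * η / 12) = S * (η ^ 2 * η) / 12 by ring, hηsq, hη, ← hexpσ,
          ← Real.exp_add, ← Real.exp_add]
        congr 1; ring
      have h4 : σ / 2 ≤ σ - 3 * (σ / (2 * ℓ ^ (7 / 10 : ℝ))) := by
        have : σ / (2 * ℓ ^ (7 / 10 : ℝ)) = (σ / ℓ ^ (7 / 10 : ℝ)) / 2 := by ring
        rw [this]; linarith
      have h5 : Real.exp (ℓ ^ (4 / 5 : ℝ) / 2) ≤ Real.exp (σ - 3 * (σ / (2 * ℓ ^ (7 / 10 : ℝ)))) :=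
        Real.exp_le_exp.mpr (by linarith)
      have h6 : (48 * ℓ ^ (2 : ℝ)) ^ 2 ≤ Real.exp (ℓ ^ (4 / 5 : ℝ) / 2) := by
        have := pow_le_pow_left₀ (by positivity) g9 2
        rwa [← Real.exp_nat_mul, show ((2 : ℕ) : ℝ) * (1 / 4 * ℓ ^ (4 / 5 : ℝ)) = ℓ ^ (4 / 5 : ℝ) / 2 by
          push_cast; ring] at this
      rw [Real.rpow_two] at h6
      rw [h3]
      exact div_le_div_of_nonneg_right (h6.trans h5) (by norm_num)
    have hE : ∀ N : ℕ, X₀ ≤ N → (N : ℝ) ≤ S → 13 * Real.sqrt N * Real.log N ^ 2 ≤ η * N := by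
      intro N hN hNS
      have hN0 : (0 : ℝ) < N := by linarith
      exact sqrt_mul_log_sq_le hN0 hN ((hlogxS N hN0 hNS).trans hσℓ) (Real.log_natCast_nonneg N)
        hη0.le hkey
    -- assemble
    have hUsum : ∀ N : ℕ, X₀ ≤ N → (N : ℝ) ≤ S →
        ‖∑ n ∈ Finset.Ioc 0 N, lCoeff m n * (n : ℂ) ^ ((t : ℂ) * I) / 2‖ ≤ 9 * η * N :=
      fun N hN hNS ↦ norm_usum_le hη0 hη1 hX₀8 hηX₀ hc₁ hC₂'0 hψ' hUx hQb hsav hN hNS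
    have hΘ := norm_twTheta_le (m := m) (t := t) hη0 hX₀8 hX₀ hUsum hE
    calc ‖primeCharSum R S m t‖ ≤ 3 * (19 * η * S) :=
          norm_primeCharSum_le_of_theta hR hS0 m t (by positivity) hΘ
      _ = 57 * S * η := by ring
      _ ≤ (57 + Cbad) * S * η := by gcongr; linarith
  · ------------------------------------------------------------------ bounded scales
    rw [not_le] at hcase
    have htriv := norm_primeCharSum_le (R := R) hS1 m t
    have hℓℓ₁ : ℓ ≤ ℓ₁ := le_trans hcase.le (le_max_left _ _)
    have hηlow : Real.exp (-(ℓ₁ ^ (3 / 10 : ℝ) / 2)) ≤ η := by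
      rw [hη]
      apply Real.exp_le_exp.mpr
      rw [neg_le_neg_iff]
      -- `σ/(2ℓ^{7/10}) ≤ ℓ/(2ℓ^{7/10}) = ℓ^{3/10}/2 ≤ ℓ₁^{3/10}/2`
      have h1 : σ / (2 * ℓ ^ (7 / 10 : ℝ)) ≤ ℓ / (2 * ℓ ^ (7 / 10 : ℝ)) :=
        div_le_div_of_nonneg_right hσℓ (by positivity)
      have h2 : ℓ / (2 * ℓ ^ (7 / 10 : ℝ)) = ℓ ^ (3 / 10 : ℝ) / 2 := by
        rw [div_eq_div_iff (by positivity) (by norm_num)]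
        have : ℓ = ℓ ^ (3 / 10 : ℝ) * ℓ ^ (7 / 10 : ℝ) := by
          rw [← Real.rpow_add hℓpos]; norm_num
        nth_rewrite 1 [this]
        ring
      have h3 : ℓ ^ (3 / 10 : ℝ) ≤ ℓ₁ ^ (3 / 10 : ℝ) := Real.rpow_le_rpow hℓpos.le hℓℓ₁ (by norm_num)
      linarith
    calc ‖primeCharSum R S m t‖ ≤ 9 * S := htriv
      _ = Cbad * S * Real.exp (-(ℓ₁ ^ (3 / 10 : ℝ) / 2)) := by
          rw [hCbad, Real.exp_neg]; field_simp
      _ ≤ Cbad * S * η := by gcongr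
      _ ≤ (57 + Cbad) * S * η := by gcongr; linarith

end GaussianInt


/-! ## Part B.  Vinogradov's estimate for the lattice sums over `ℤ[i]` (Coleman's Theorem 1 for `ℚ(i)`)

We discharge the parametrised hypothesis `GaussianHecke.LatticeExpSumBound C D` of `GaussianHeckeRichertBound.lean`
(`D = 10¹⁴`).  The annulus `{M < N z ≤ u}` splits into the part `|Re z| ≤ |Im z|` and the part `|Im z| < |Re z|`;
multiplication by `i` (`λ^m(iz) = λ^m(z)`, `N(iz) = N(z)`) maps the second onto `{|Re z| < |Im z|}`.  Each of these is
a union over the lines `Im z = b`, `M/2 < b² ≤ u`, of at most two integer intervals in `|a| ≤ |b|` (the sets `{a ≥ 0}`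
and `{a < 0}` on a line are order-convex), to which the estimate on a line `GaussLine.norm_lineSum_le` applies with
`ℓ_b = log|b| ≈ ½ log M` and `Y_b = log|4m − 2ti|/ℓ_b ≥ 0.12`; there are `≤ 3√u` lines and `11|b| ≤ 11√u`.  For
`log M < 2·10¹⁴ + 2` the trivial bound `≤ 9u` suffices.  [cite: ColemanMathematika1990, Theorem 1]
[cite: Ivic1985, Theorem 6.2] -/

namespace GaussianHecke

open GaussianInt GaussianTheta Real

/-! ### Finite order-convex subsets of `ℤ` are intervals -/

/-- A nonempty finite order-convex subset of `ℤ` is the interval between its minimum and maximum. [folklore] -/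
theorem eq_Icc_of_convex {T : Finset ℤ} (hT : T.Nonempty)
    (hconv : ∀ x ∈ T, ∀ y ∈ T, ∀ z : ℤ, x ≤ z → z ≤ y → z ∈ T) :
    T = Icc (T.min' hT) (T.max' hT) := by
  ext z
  constructor
  · intro hz; rw [mem_Icc]; exact ⟨T.min'_le z hz, T.le_max' z hz⟩
  · intro hz; rw [mem_Icc] at hz; exact hconv _ (T.min'_mem hT) _ (T.max'_mem hT) z hz.1 hz.2

/-! ### Counting lattice points -/

/-- `|Re z|, |Im z| ≤ ⌊√u⌋` for `N(z) ≤ u`. [folklore] -/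
theorem abs_re_im_le_of_mem_normLE {u : ℝ} {z : GaussianInt} (hz : z ∈ normLE u) :
    |z.re| ≤ (⌊Real.sqrt u⌋₊ : ℤ) ∧ |z.im| ≤ (⌊Real.sqrt u⌋₊ : ℤ) := by
  rw [mem_normLE] at hz
  have hnorm : (z.norm : ℝ) = (z.re : ℝ) ^ 2 + (z.im : ℝ) ^ 2 := by
    rw [Zsqrtd.norm_def]; push_cast; ring
  have hre : (z.re : ℝ) ^ 2 ≤ u := by nlinarith [sq_nonneg (z.im : ℝ)]
  have him : (z.im : ℝ) ^ 2 ≤ u := by nlinarith [sq_nonneg (z.re : ℝ)]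
  have key : ∀ x : ℤ, (x : ℝ) ^ 2 ≤ u → |x| ≤ (⌊Real.sqrt u⌋₊ : ℤ) := by
    intro x hx
    have h1 : |(x : ℝ)| ≤ Real.sqrt u := Real.abs_le_sqrt hx
    have h2 : (x.natAbs : ℝ) ≤ Real.sqrt u := by
      rw [Nat.cast_natAbs]; push_cast; exact h1
    have h3 : x.natAbs ≤ ⌊Real.sqrt u⌋₊ := Nat.le_floor h2
    rw [← Int.natCast_natAbs]
    exact_mod_cast h3
  exact ⟨key z.re hre, key z.im him⟩

/-- **The trivial bound** `‖∑_{M < N z ≤ u} λ^m(z) N(z)^{-it}‖ ≤ 9u` (`u ≥ 1`). [folklore] -/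
theorem norm_latticeBlockSum_le_trivial (m : ℕ) (t : ℝ) (M : ℕ) {u : ℕ} (hu : 1 ≤ u) :
    ‖latticeBlockSum m t M u‖ ≤ 9 * u := by
  classical
  unfold latticeBlockSum
  refine (norm_sum_le _ _).trans ?_
  have h1 : ∀ z ∈ (normLE (u : ℝ)).filter (fun z : GaussianInt ↦ (M : ℤ) < z.norm),
      ‖angularChar m z * (((z.norm : ℝ)) : ℂ) ^ (-(t * I))‖ ≤ 1 := by
    intro z hz
    rw [mem_filter] at hz
    have hz0 : z ≠ 0 := by
      intro h0; rw [h0, Zsqrtd.norm_zero] at hz; have := hz.2; omega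
    exact (GaussLine.norm_phase_eq_one m t hz0).le
  calc ∑ z ∈ (normLE (u : ℝ)).filter (fun z : GaussianInt ↦ (M : ℤ) < z.norm),
        ‖angularChar m z * (((z.norm : ℝ)) : ℂ) ^ (-(t * I))‖
      ≤ ∑ _z ∈ (normLE (u : ℝ)).filter (fun z : GaussianInt ↦ (M : ℤ) < z.norm), (1 : ℝ) := sum_le_sum h1
    _ = ((normLE (u : ℝ)).filter (fun z : GaussianInt ↦ (M : ℤ) < z.norm)).card := by simp
    _ ≤ (normLE (u : ℝ)).card := by exact_mod_cast card_filter_le _ _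
    _ ≤ 9 * u := card_normLE_le_nine_mul hu

/-! ### Rotation by `i` -/

/-- `λ^m(iz) = λ^m(z)` and `N(iz) = N(z)`, `iz = ⟨−Im z, Re z⟩`. [folklore] -/
theorem phase_rot (m : ℕ) (t : ℝ) (z : GaussianInt) :
    angularChar m (⟨-z.im, z.re⟩ : GaussianInt) * ((((⟨-z.im, z.re⟩ : GaussianInt).norm : ℝ)) : ℂ) ^ (-(t * I)) =
      angularChar m z * (((z.norm : ℝ)) : ℂ) ^ (-(t * I)) := by
  have hmul : (⟨-z.im, z.re⟩ : GaussianInt) = (⟨0, 1⟩ : GaussianInt) * z := by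
    ext <;> simp [Zsqrtd.re_mul, Zsqrtd.im_mul]
  have hunit : IsUnit (⟨0, 1⟩ : GaussianInt) := by
    rw [isUnit_iff_norm_eq_one]; rfl
  have hnorm : (⟨-z.im, z.re⟩ : GaussianInt).norm = z.norm := by
    rw [Zsqrtd.norm_def, Zsqrtd.norm_def]; ring
  rw [hnorm, hmul, angularChar_unit_mul m hunit]

/-- **Rotation**: for a rotation-invariant `f` and a rotation-invariant set condition through the norm,
`∑_{z ∈ S, ¬(|Re z| ≤ |Im z|)} f z = ∑_{z ∈ S, |Re z| < |Im z|} f z`, where `S = {M < N z ≤ u}`. [folklore] -/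
theorem sum_filter_rot (f : GaussianInt → ℂ) (hf : ∀ z : GaussianInt, f ⟨-z.im, z.re⟩ = f z) (M : ℕ) (u : ℝ) :
    ∑ z ∈ ((normLE u).filter (fun z : GaussianInt ↦ (M : ℤ) < z.norm)).filter
        (fun z : GaussianInt ↦ ¬ (|z.re| ≤ |z.im|)), f z =
      ∑ z ∈ ((normLE u).filter (fun z : GaussianInt ↦ (M : ℤ) < z.norm)).filter
        (fun z : GaussianInt ↦ |z.re| < |z.im|), f z := by
  classical
  refine Finset.sum_nbij' (fun z : GaussianInt ↦ (⟨-z.im, z.re⟩ : GaussianInt))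
    (fun z : GaussianInt ↦ (⟨z.im, -z.re⟩ : GaussianInt)) ?_ ?_ ?_ ?_ ?_
  · intro z hz
    simp only [mem_filter, mem_normLE] at hz ⊢
    have hn : (⟨-z.im, z.re⟩ : GaussianInt).norm = z.norm := by rw [Zsqrtd.norm_def, Zsqrtd.norm_def]; ring
    refine ⟨⟨by rw [hn]; exact hz.1.1, by rw [hn]; exact hz.1.2⟩, ?_⟩
    simp only [abs_neg]
    exact lt_of_not_ge hz.2
  · intro z hz
    simp only [mem_filter, mem_normLE] at hz ⊢
    have hn : (⟨z.im, -z.re⟩ : GaussianInt).norm = z.norm := by rw [Zsqrtd.norm_def, Zsqrtd.norm_def]; ring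
    refine ⟨⟨by rw [hn]; exact hz.1.1, by rw [hn]; exact hz.1.2⟩, ?_⟩
    simp only [abs_neg, not_le]
    exact hz.2
  · intro z _; ext <;> simp
  · intro z _; ext <;> simp
  · intro z _; exact (hf z).symm

/-! ### The lines: one fibre `Im z = b` is a union of two intervals -/

/-- **One fibre.**  Let `q` be a condition on lattice points with `q(a + bi) → |a| ≤ |b|` which, on the line `Im z = b`,
is order-convex on `a ≥ 0` and on `a < 0`.  If `‖∑_{A₁ ≤ a ≤ A₂} f a‖ ≤ F` for every integer interval
`[A₁, A₂] ⊆ [−|b|, |b|]`, then the fibre `Im z = b` of `{M < N z ≤ u, q z}` contributes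
`‖∑_{z} f(Re z)‖ ≤ 2F` (the parts `Re z ≥ 0` and `Re z < 0` are intervals, `eq_Icc_of_convex`). [folklore] -/
theorem norm_sum_fibre_le (f : ℤ → ℂ) (q : GaussianInt → Prop) [DecidablePred q] {M : ℕ} {u : ℝ} {b : ℤ}
    (hqb : ∀ a : ℤ, q ⟨a, b⟩ → |a| ≤ |b|)
    (hqpos : ∀ a₁ a₂ a : ℤ, q ⟨a₁, b⟩ → q ⟨a₂, b⟩ → 0 ≤ a₁ → a₁ ≤ a → a ≤ a₂ → q ⟨a, b⟩)
    (hqneg : ∀ a₁ a₂ a : ℤ, q ⟨a₁, b⟩ → q ⟨a₂, b⟩ → a₂ < 0 → a₁ ≤ a → a ≤ a₂ → q ⟨a, b⟩)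
    {F : ℝ} (hF0 : 0 ≤ F) (hF : ∀ A₁ A₂ : ℤ, -|b| ≤ A₁ → A₂ ≤ |b| → ‖∑ a ∈ Icc A₁ A₂, f a‖ ≤ F) :
    ‖∑ z ∈ (((normLE u).filter (fun z : GaussianInt ↦ (M : ℤ) < z.norm)).filter q).filter
        (fun z : GaussianInt ↦ z.im = b), f z.re‖ ≤ 2 * F := by
  classical
  set Tb := (((normLE u).filter (fun z : GaussianInt ↦ (M : ℤ) < z.norm)).filter q).filter
    (fun z : GaussianInt ↦ z.im = b) with hTb
  -- pass to the real parts
  have hinj : Set.InjOn (fun z : GaussianInt ↦ z.re) ↑Tb := by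
    intro z hz w hw h
    rw [Finset.mem_coe, hTb, mem_filter] at hz hw
    exact Zsqrtd.ext h (by rw [hz.2, hw.2])
  rw [← sum_image hinj]
  set R : Finset ℤ := Tb.image (fun z : GaussianInt ↦ z.re) with hR
  -- membership in `R`
  have hnormab : ∀ a : ℤ, ((⟨a, b⟩ : GaussianInt)).norm = a ^ 2 + b ^ 2 := fun a ↦ by
    rw [Zsqrtd.norm_def]; ring
  have hmemR : ∀ a : ℤ, a ∈ R ↔ ((M : ℤ) < a ^ 2 + b ^ 2 ∧ (((a ^ 2 + b ^ 2 : ℤ)) : ℝ) ≤ u) ∧ q ⟨a, b⟩ := by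
    intro a
    rw [hR, mem_image]
    constructor
    · rintro ⟨z, hz, rfl⟩
      rw [hTb, mem_filter, mem_filter, mem_filter, mem_normLE] at hz
      obtain ⟨⟨⟨h1, h2⟩, h3⟩, h4⟩ := hz
      have hz' : z = ⟨z.re, b⟩ := Zsqrtd.ext rfl h4
      rw [hz', hnormab] at h1 h2
      rw [hz'] at h3
      exact ⟨⟨h2, by exact_mod_cast h1⟩, h3⟩
    · rintro ⟨⟨h1, h2⟩, h3⟩
      refine ⟨⟨a, b⟩, ?_, rfl⟩
      rw [hTb, mem_filter, mem_filter, mem_filter, mem_normLE, hnormab]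
      exact ⟨⟨⟨by exact_mod_cast h2, h1⟩, h3⟩, rfl⟩
  -- the two halves
  rw [← sum_filter_add_sum_filter_not R (fun a : ℤ ↦ 0 ≤ a)]
  have hhalf : ∀ (P : ℤ → Prop) [DecidablePred P],
      (∀ x y z : ℤ, x ∈ R.filter P → y ∈ R.filter P → x ≤ z → z ≤ y → z ∈ R.filter P) →
      ‖∑ a ∈ R.filter P, f a‖ ≤ F := by
    intro P _ hconv
    rcases (R.filter P).eq_empty_or_nonempty with he | hne
    · rw [he, sum_empty, norm_zero]; exact hF0
    · rw [eq_Icc_of_convex hne (fun x hx y hy z hxz hzy ↦ hconv x y z hx hy hxz hzy)]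
      have hmin := (R.filter P).min'_mem hne
      have hmax := (R.filter P).max'_mem hne
      rw [mem_filter] at hmin hmax
      have h1 := hqb _ ((hmemR _).mp hmin.1).2
      have h2 := hqb _ ((hmemR _).mp hmax.1).2
      exact hF _ _ (by linarith [abs_le.mp h1]) (by linarith [abs_le.mp h2])
  have hpos : ‖∑ a ∈ R.filter (fun a : ℤ ↦ 0 ≤ a), f a‖ ≤ F := by
    refine hhalf _ fun x y z hx hy hxz hzy ↦ ?_
    rw [mem_filter, hmemR] at hx hy ⊢
    obtain ⟨⟨⟨hx1, hx2⟩, hx3⟩, hx0⟩ := hx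
    obtain ⟨⟨⟨hy1, hy2⟩, hy3⟩, hy0⟩ := hy
    have hz0 : 0 ≤ z := le_trans hx0 hxz
    have hxz2 : x ^ 2 ≤ z ^ 2 := pow_le_pow_left₀ hx0 hxz 2
    have hzy2 : z ^ 2 ≤ y ^ 2 := pow_le_pow_left₀ hz0 hzy 2
    refine ⟨⟨⟨by linarith, ?_⟩, hqpos x y z hx3 hy3 hx0 hxz hzy⟩, hz0⟩
    have : ((z ^ 2 + b ^ 2 : ℤ) : ℝ) ≤ ((y ^ 2 + b ^ 2 : ℤ) : ℝ) := by exact_mod_cast (by linarith)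
    exact this.trans hy2
  have hneg : ‖∑ a ∈ R.filter (fun a : ℤ ↦ ¬ 0 ≤ a), f a‖ ≤ F := by
    refine hhalf _ fun x y z hx hy hxz hzy ↦ ?_
    rw [mem_filter, hmemR] at hx hy ⊢
    obtain ⟨⟨⟨hx1, hx2⟩, hx3⟩, hx0⟩ := hx
    obtain ⟨⟨⟨hy1, hy2⟩, hy3⟩, hy0⟩ := hy
    rw [not_le] at hx0 hy0
    have hz0 : z < 0 := lt_of_le_of_lt hzy hy0
    have hzy2 : y ^ 2 ≤ z ^ 2 := by nlinarith
    have hxz2 : z ^ 2 ≤ x ^ 2 := by nlinarith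
    refine ⟨⟨⟨by linarith, ?_⟩, hqneg x y z hx3 hy3 hy0 hxz hzy⟩, not_le.mpr hz0⟩
    have : ((z ^ 2 + b ^ 2 : ℤ) : ℝ) ≤ ((x ^ 2 + b ^ 2 : ℤ) : ℝ) := by exact_mod_cast (by linarith)
    exact this.trans hx2
  calc ‖∑ a ∈ R.filter (fun a : ℤ ↦ 0 ≤ a), f a + ∑ a ∈ R.filter (fun a : ℤ ↦ ¬ 0 ≤ a), f a‖
      ≤ ‖∑ a ∈ R.filter (fun a : ℤ ↦ 0 ≤ a), f a‖ + ‖∑ a ∈ R.filter (fun a : ℤ ↦ ¬ 0 ≤ a), f a‖ := norm_add_le _ _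
    _ ≤ F + F := add_le_add hpos hneg
    _ = 2 * F := by ring

/-- The number of lines: `#(T.image Im) ≤ 3√u` for `T ⊆ {N z ≤ u}`, `u ≥ 1`. [folklore] -/
theorem card_image_im_le {u : ℝ} (hu : 1 ≤ u) {T : Finset GaussianInt} (hT : ∀ z ∈ T, z ∈ normLE u) :
    ((T.image fun z : GaussianInt ↦ z.im).card : ℝ) ≤ 3 * Real.sqrt u := by
  classical
  set K : ℕ := ⌊Real.sqrt u⌋₊ with hK
  have hsub : (T.image fun z : GaussianInt ↦ z.im) ⊆ Icc (-(K : ℤ)) K := by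
    intro b hb
    rw [mem_image] at hb
    obtain ⟨z, hz, rfl⟩ := hb
    have := (abs_re_im_le_of_mem_normLE (hT z hz)).2
    rw [mem_Icc]; exact abs_le.mp this
  have h1 := card_le_card hsub
  rw [Int.card_Icc, show ((K : ℤ) + 1 - -(K : ℤ)).toNat = 2 * K + 1 by omega] at h1
  have hKu : (K : ℝ) ≤ Real.sqrt u := Nat.floor_le (Real.sqrt_nonneg u)
  have h1s : 1 ≤ Real.sqrt u := by rw [← Real.sqrt_one]; exact Real.sqrt_le_sqrt hu
  calc ((T.image fun z : GaussianInt ↦ z.im).card : ℝ) ≤ ((2 * K + 1 : ℕ) : ℝ) := by exact_mod_cast h1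
    _ = 2 * (K : ℝ) + 1 := by push_cast; ring
    _ ≤ 3 * Real.sqrt u := by linarith

/-! ### Real-variable facts for the lines -/

/-- `log x ≤ 10⁻⁵ x` for `x ≥ 4·10¹⁰` (`log x = 2 log √x ≤ 2√x ≤ 10⁻⁵ x`). [folklore] -/
theorem log_le_small_mul {x : ℝ} (hx : 4e10 ≤ x) : Real.log x ≤ 1e-5 * x := by
  have hx0 : 0 < x := by linarith
  have hs : Real.sqrt x * Real.sqrt x = x := Real.mul_self_sqrt hx0.le
  have hs0 : 0 < Real.sqrt x := Real.sqrt_pos.mpr hx0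
  have hlog : Real.log x = 2 * Real.log (Real.sqrt x) := by
    rw [← Real.log_rpow hs0 2, Real.rpow_two, sq, hs]
  have h1 : Real.log (Real.sqrt x) ≤ Real.sqrt x - 1 := Real.log_le_sub_one_of_pos hs0
  have h2 : 2e5 ≤ Real.sqrt x := by
    rw [show (2e5 : ℝ) = Real.sqrt (4e10) by rw [show (4e10 : ℝ) = 2e5 ^ 2 by norm_num, Real.sqrt_sq (by norm_num)]]
    exact Real.sqrt_le_sqrt hx
  rw [hlog]
  nlinarith [hs]

/-- **The parameters of a line.**  With `L_M = log M ≥ 2·10¹⁴ + 2`, `L_M ≤ 4L_V`, `L_V − 0.7 ≤ L_τ ≤ L_V + 1.4` and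
`L_M/2 − 0.35 ≤ ℓ_b ≤ L_M/2 + 0.35` (`ℓ_b = log|b|` on a line of the annulus): `ℓ_b ≥ 10¹⁴`, `Y_b = L_τ/ℓ_b ≥ 0.12`, and
`L_M³/(10¹⁴ L_V²) ≤ ℓ_b/(10¹² max(1, Y_b²))`. [folklore] -/
theorem line_exponent_facts {LM LV Lτ ℓb : ℝ} (hLM : 2e14 + 2 ≤ LM) (hMV : LM ≤ 4 * LV) (hτ1 : Lτ ≤ LV + 1.4)
    (hτ2 : LV - 0.7 ≤ Lτ) (hb1 : LM / 2 - 0.35 ≤ ℓb) (hb2 : ℓb ≤ LM / 2 + 0.35) :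
    1e14 ≤ ℓb ∧ 0.12 ≤ Lτ / ℓb ∧ LM ^ 3 / (1e14 * LV ^ 2) ≤ ℓb / (1e12 * max 1 ((Lτ / ℓb) ^ 2)) := by
  have hℓb : 1e14 ≤ ℓb := by linarith
  have hℓb0 : 0 < ℓb := by linarith
  have hLV : 5e13 ≤ LV := by linarith
  have hLV0 : 0 < LV := by linarith
  have hLτ0 : 0 < Lτ := by linarith
  have hY : 0.12 ≤ Lτ / ℓb := by
    rw [le_div_iff₀ hℓb0]; nlinarith
  refine ⟨hℓb, hY, ?_⟩
  have hℓbM : 0.49 * LM ≤ ℓb := by linarith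
  have hLM0 : 0 ≤ LM := by linarith
  rcases le_or_gt ((Lτ / ℓb) ^ 2) 1 with h | h
  · rw [max_eq_left h, mul_one, div_le_div_iff₀ (by positivity) (by norm_num)]
    have h1 : LM ^ 2 ≤ 16 * LV ^ 2 := by nlinarith
    have h2 : LM ^ 3 * 1e12 ≤ 16 * LV ^ 2 * LM * 1e12 := by nlinarith [mul_le_mul_of_nonneg_right h1 hLM0]
    have h3 : 0.49 * LM * (1e14 * LV ^ 2) ≤ ℓb * (1e14 * LV ^ 2) :=
      mul_le_mul_of_nonneg_right hℓbM (by positivity)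
    nlinarith [h2, h3, mul_nonneg hLM0 (sq_nonneg LV)]
  · rw [max_eq_right h.le]
    have hY0 : 0 < Lτ / ℓb := by positivity
    have heq : ℓb / (1e12 * (Lτ / ℓb) ^ 2) = ℓb ^ 3 / (1e12 * Lτ ^ 2) := by
      field_simp
    rw [heq, div_le_div_iff₀ (by positivity) (by positivity)]
    have h1 : (0.49 * LM) ^ 3 ≤ ℓb ^ 3 := pow_le_pow_left₀ (by positivity) hℓbM 3
    have h2 : Lτ ≤ 1.01 * LV := by linarith
    have h3 : Lτ ^ 2 ≤ (1.01 * LV) ^ 2 := pow_le_pow_left₀ hLτ0.le h2 2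
    have hLM3 : 0 ≤ LM ^ 3 := by positivity
    have h4 : LM ^ 3 * (1e12 * Lτ ^ 2) ≤ LM ^ 3 * (1e12 * (1.01 * LV) ^ 2) := by
      apply mul_le_mul_of_nonneg_left _ hLM3; linarith
    have h5 : (0.49 * LM) ^ 3 * (1e14 * LV ^ 2) ≤ ℓb ^ 3 * (1e14 * LV ^ 2) :=
      mul_le_mul_of_nonneg_right h1 (by positivity)
    nlinarith [h4, h5, mul_nonneg hLM3 (sq_nonneg LV)]

/-! ### The main theorem -/

/-- `log 4 ≤ 1.4`, `log 2 ≤ 0.7` and `1 < log 4`. [folklore] -/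
theorem log_four_facts : Real.log 4 ≤ 1.4 ∧ Real.log 2 ≤ 0.7 ∧ 1 < Real.log 4 := by
  have h4 : Real.log 4 = 2 * Real.log 2 := by
    rw [show (4 : ℝ) = 2 ^ 2 by norm_num, Real.log_pow]; ring
  have h2 := Real.log_two_lt_d9
  have h2' := Real.log_two_gt_d9
  refine ⟨by rw [h4]; linarith, by linarith, by rw [h4]; linarith⟩

set_option maxHeartbeats 4000000 in
/-- **Vinogradov's estimate for the lattice sums over `ℤ[i]` (Coleman's Theorem 1 for `ℚ(i)`, conductor `1`)**:
`∃ C D, GaussianHecke.LatticeExpSumBound C D` (with `D = 10¹⁴`), i.e. for `m ≥ 1`, real `t`, `1 ≤ M ≤ u ≤ 2M`,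
`M ≤ V⁴`:  `‖∑_{M < N z ≤ u} λ^m(z) N(z)^{-it}‖ ≤ C · M^{1 − (log M)²/(10¹⁴ (log V)²)}`, `V = m + |t| + 3`.
[cite: ColemanMathematika1990, Theorem 1] [cite: Ivic1985, Theorem 6.2] -/
theorem exists_latticeExpSumBound : ∃ C D : ℝ, 0 ≤ C ∧ 0 < D ∧ LatticeExpSumBound C D := by
  classical
  refine ⟨18 * Real.exp 33 + 300, 1e14, by positivity, by norm_num, ?_⟩
  intro m t M u hm hM hMu hu2 hMV
  obtain ⟨hlog4, hlog2, hlog4'⟩ := log_four_facts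
  -- ### the scales
  set V : ℝ := (m : ℝ) + |t| + 3 with hVdef
  have hm1 : (1 : ℝ) ≤ m := by exact_mod_cast hm
  have hV4 : 4 ≤ V := by rw [hVdef]; linarith [abs_nonneg t]
  have hV0 : 0 < V := by linarith
  set LV : ℝ := Real.log V with hLVdef
  have hLV1 : 1 < LV := lt_of_lt_of_le hlog4' (Real.log_le_log (by norm_num) hV4)
  have hLV0 : 0 < LV := by linarith
  have hM1 : (1 : ℝ) ≤ M := by exact_mod_cast hM
  have hM0 : (0 : ℝ) < M := by linarith
  set LM : ℝ := Real.log M with hLMdef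
  have hLM0 : 0 ≤ LM := Real.log_nonneg hM1
  have hLM4 : LM ≤ 4 * LV := by
    have : Real.log M ≤ Real.log (V ^ 4) := Real.log_le_log hM0 hMV
    rwa [Real.log_pow, Nat.cast_ofNat] at this
  have hu1 : 1 ≤ u := le_trans hM hMu
  have hu1r : (1 : ℝ) ≤ u := by exact_mod_cast hu1
  have huM : (u : ℝ) ≤ 2 * M := by exact_mod_cast hu2
  -- ### the target in the form `C · M · exp(−LM³/(10¹⁴ LV²))`
  set E : ℝ := LM ^ 3 / (1e14 * LV ^ 2) with hEdef
  have hE0 : 0 ≤ E := by rw [hEdef]; positivity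
  have htarget : (M : ℝ) ^ (1 - LM ^ 2 / (1e14 * LV ^ 2)) = M * Real.exp (-E) := by
    rw [Real.rpow_def_of_pos hM0, ← hLMdef]
    conv_rhs => rw [← Real.exp_log hM0, ← hLMdef, ← Real.exp_add]
    congr 1
    rw [hEdef]; field_simp; ring
  rw [htarget]
  -- ### the trivial range `LM < 2·10¹⁴ + 2`
  have htriv := norm_latticeBlockSum_le_trivial m t M hu1
  by_cases hsmall : LM < 2e14 + 2
  · have hE33 : E ≤ 33 := by
      rw [hEdef, div_le_iff₀ (by positivity)]
      have h1 : LM ^ 2 ≤ 16 * LV ^ 2 := by nlinarith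
      nlinarith [mul_le_mul_of_nonneg_left h1 hLM0]
    have hexp : Real.exp (-33) ≤ Real.exp (-E) := Real.exp_le_exp.mpr (by linarith)
    calc ‖latticeBlockSum m t M u‖ ≤ 9 * u := htriv
      _ ≤ 18 * M := by linarith
      _ = 18 * Real.exp 33 * (M * Real.exp (-33)) := by
          rw [show (18 : ℝ) * Real.exp 33 * (M * Real.exp (-33)) = 18 * M * (Real.exp 33 * Real.exp (-33)) by ring,
            ← Real.exp_add]; norm_num
      _ ≤ 18 * Real.exp 33 * (M * Real.exp (-E)) := by gcongr
      _ ≤ (18 * Real.exp 33 + 300) * (M * Real.exp (-E)) := by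
          have : 0 ≤ M * Real.exp (-E) := by positivity
          nlinarith
  rw [not_lt] at hsmall
  -- ### the frequency `τ = |4m − 2ti|`
  set w : ℂ := 4 * (m : ℂ) - 2 * t * I with hw
  set τ : ℝ := ‖w‖ with hτdef
  have hτlo : V / 2 ≤ τ := by
    have h1 : (4 * (m : ℝ)) ≤ τ := by
      have := Complex.abs_re_le_norm w
      have hre : w.re = 4 * m := by simp [hw]
      rw [hre, abs_of_nonneg (by positivity)] at this; exact this
    have h2 : 2 * |t| ≤ τ := by
      have := Complex.abs_im_le_norm w
      have him : w.im = -(2 * t) := by simp [hw]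
      rw [him, abs_neg, abs_mul, abs_two] at this; exact this
    rw [hVdef]; linarith
  have hτhi : τ ≤ 4 * V := by
    have hn1 : ‖(4 * (m : ℂ))‖ = 4 * m := by
      rw [norm_mul, Complex.norm_natCast]; norm_num
    have hn2 : ‖2 * (t : ℂ) * I‖ = 2 * |t| := by
      rw [norm_mul, norm_mul, Complex.norm_I, mul_one, Complex.norm_real, Real.norm_eq_abs]; norm_num
    calc τ = ‖(4 * (m : ℂ)) - 2 * t * I‖ := rfl
      _ ≤ ‖(4 * (m : ℂ))‖ + ‖2 * (t : ℂ) * I‖ := norm_sub_le _ _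
      _ = 4 * m + 2 * |t| := by rw [hn1, hn2]
      _ ≤ 4 * V := by rw [hVdef]; linarith [abs_nonneg t]
  have hτ0 : 0 < τ := by linarith
  set Lτ : ℝ := Real.log τ with hLτdef
  have hLτ1 : Lτ ≤ LV + 1.4 := by
    calc Lτ ≤ Real.log (4 * V) := Real.log_le_log hτ0 hτhi
      _ = Real.log 4 + LV := by rw [Real.log_mul (by norm_num) hV0.ne']
      _ ≤ LV + 1.4 := by linarith
  have hLτ2 : LV - 0.7 ≤ Lτ := by
    have : Real.log (V / 2) ≤ Lτ := Real.log_le_log (by positivity) hτlo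
    rw [Real.log_div hV0.ne' (by norm_num)] at this
    linarith
  -- ### the summand and the pieces
  set Φ : GaussianInt → ℂ := fun z ↦ angularChar m z * (((z.norm : ℝ)) : ℂ) ^ (-(t * I)) with hΦ
  set S : Finset GaussianInt := (normLE (u : ℝ)).filter (fun z : GaussianInt ↦ (M : ℤ) < z.norm) with hS
  have hSsum : latticeBlockSum m t M u = ∑ z ∈ S, Φ z := rfl
  have hsplit : ∑ z ∈ S, Φ z = ∑ z ∈ S.filter (fun z : GaussianInt ↦ |z.re| ≤ |z.im|), Φ z +
      ∑ z ∈ S.filter (fun z : GaussianInt ↦ |z.re| < |z.im|), Φ z := by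
    rw [← sum_filter_add_sum_filter_not S (fun z : GaussianInt ↦ |z.re| ≤ |z.im|)]
    congr 1
    exact sum_filter_rot Φ (fun z ↦ phase_rot m t z) M u
  -- ### the uniform bound on an interval of a line: `F = 11 √u e^{-E}`
  set F : ℝ := 11 * Real.sqrt u * Real.exp (-E) with hFdef
  have hF0 : 0 ≤ F := by rw [hFdef]; positivity
  have hsqu : Real.sqrt u * Real.sqrt u = u := Real.mul_self_sqrt (by positivity)
  -- for a height `b` occurring in the annulus with `b² ≥ N z /2`
  have hline : ∀ b : ℤ, (∃ z : GaussianInt, z ∈ S ∧ |z.re| ≤ |z.im| ∧ z.im = b) →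
      ∀ A₁ A₂ : ℤ, -|b| ≤ A₁ → A₂ ≤ |b| →
        ‖∑ a ∈ Icc A₁ A₂, Φ ⟨a, b⟩‖ ≤ F := by
    intro b hb A₁ A₂ hA₁ hA₂
    obtain ⟨z, hzS, hzre, hzim⟩ := hb
    rw [hS, mem_filter, mem_normLE] at hzS
    obtain ⟨hzu, hzM⟩ := hzS
    have hnorm : z.norm = z.re ^ 2 + b ^ 2 := by rw [Zsqrtd.norm_def, ← hzim]; ring
    have hre2 : z.re ^ 2 ≤ b ^ 2 := by
      rw [← sq_abs z.re, ← sq_abs b, ← hzim]; exact pow_le_pow_left₀ (abs_nonneg _) hzre 2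
    -- `M/2 < b² ≤ u`
    have hb2u : ((b : ℝ)) ^ 2 ≤ u := by
      have : ((b ^ 2 : ℤ) : ℝ) ≤ ((z.norm : ℤ) : ℝ) := by exact_mod_cast (by rw [hnorm]; nlinarith)
      push_cast at this; linarith
    have hb2M : (M : ℝ) < 2 * (b : ℝ) ^ 2 := by
      have h1 : (M : ℤ) < 2 * b ^ 2 := by rw [hnorm] at hzM; linarith
      exact_mod_cast h1
    have hb0 : b ≠ 0 := by rintro rfl; simp at hb2M; linarith
    have hbR0 : 0 < |(b : ℝ)| := abs_pos.mpr (by exact_mod_cast hb0)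
    -- `ℓ_b = log|b|`
    set ℓb : ℝ := Real.log |(b : ℝ)| with hℓbdef
    have hℓb2 : 2 * ℓb = Real.log ((b : ℝ) ^ 2) := by
      rw [hℓbdef, ← sq_abs (b : ℝ), Real.log_pow, Nat.cast_ofNat]
    have hℓb_lo : LM / 2 - 0.35 ≤ ℓb := by
      have h1 : Real.log (M / 2) ≤ Real.log ((b : ℝ) ^ 2) := Real.log_le_log (by positivity) (by linarith)
      rw [Real.log_div hM0.ne' (by norm_num), ← hLMdef] at h1
      linarith
    have hℓb_hi : ℓb ≤ LM / 2 + 0.35 := by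
      have h1 : Real.log ((b : ℝ) ^ 2) ≤ Real.log (2 * M) :=
        Real.log_le_log (by positivity) (hb2u.trans huM)
      rw [Real.log_mul (by norm_num) hM0.ne', ← hLMdef] at h1
      linarith
    obtain ⟨hℓb14, hYb, hEb⟩ := line_exponent_facts hsmall hLM4 hLτ1 hLτ2 hℓb_lo hℓb_hi
    have hℓb0 : 0 < ℓb := by linarith
    set Yb : ℝ := Lτ / ℓb with hYbdef
    have hYℓ : Yb * ℓb = Real.log ‖(4 * (m : ℂ) - 2 * t * I)‖ := by
      rw [hYbdef, div_mul_cancel₀ _ hℓb0.ne']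
    have hc2 : Real.log ℓb ≤ 1e-5 * ℓb := log_le_small_mul (by linarith)
    have hL := GaussLine.norm_lineSum_le hb0 hA₁ hA₂ m t rfl hYℓ hYb hℓb14 hc2
    refine hL.trans ?_
    rw [hFdef]
    have hbu : |(b : ℝ)| ≤ Real.sqrt u := Real.abs_le_sqrt hb2u
    have hexp : Real.exp (-(ℓb / (1e12 * max 1 (Yb ^ 2)))) ≤ Real.exp (-E) :=
      Real.exp_le_exp.mpr (neg_le_neg hEb)
    gcongr
  -- ### one piece `T = S.filter q'` (`q' = p` or `q`): fibrewise over the lines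
  have hpiece : ∀ (q' : GaussianInt → Prop) [DecidablePred q'],
      (∀ z, q' z → |z.re| ≤ |z.im|) →
      (∀ (b a : ℤ), q' ⟨a, b⟩ → |a| ≤ |b|) →
      (∀ b a₁ a₂ a : ℤ, q' ⟨a₁, b⟩ → q' ⟨a₂, b⟩ → 0 ≤ a₁ → a₁ ≤ a → a ≤ a₂ → q' ⟨a, b⟩) →
      (∀ b a₁ a₂ a : ℤ, q' ⟨a₁, b⟩ → q' ⟨a₂, b⟩ → a₂ < 0 → a₁ ≤ a → a ≤ a₂ → q' ⟨a, b⟩) →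
      ‖∑ z ∈ S.filter q', Φ z‖ ≤ 3 * Real.sqrt u * (2 * F) := by
    intro q' _ hq'1 hq'2 hq'3 hq'4
    set T := S.filter q' with hT
    have hTS : ∀ z ∈ T, z ∈ normLE (u : ℝ) := by
      intro z hz; rw [hT, mem_filter, hS, mem_filter] at hz; exact hz.1.1
    rw [← sum_fiberwise_of_maps_to (g := fun z : GaussianInt ↦ z.im) (t := T.image fun z : GaussianInt ↦ z.im)
      (fun z hz ↦ mem_image_of_mem _ hz)]
    refine (norm_sum_le _ _).trans ?_
    have hfib : ∀ b ∈ T.image (fun z : GaussianInt ↦ z.im), ‖∑ z ∈ T.filter (fun z ↦ z.im = b), Φ z‖ ≤ 2 * F := by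
      intro b hb
      -- rewrite the summand through the real part
      have hsum : ∑ z ∈ T.filter (fun z ↦ z.im = b), Φ z =
          ∑ z ∈ T.filter (fun z ↦ z.im = b), (fun a : ℤ ↦ Φ ⟨a, b⟩) z.re := by
        refine sum_congr rfl fun z hz ↦ ?_
        rw [mem_filter] at hz
        have : z = ⟨z.re, b⟩ := Zsqrtd.ext rfl hz.2
        conv_lhs => rw [this]
      rw [hsum, hT, hS]
      refine norm_sum_fibre_le (fun a : ℤ ↦ Φ ⟨a, b⟩) q' (hq'2 b) (hq'3 b) (hq'4 b) hF0 ?_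
      apply hline b
      rw [mem_image] at hb
      obtain ⟨z, hz, hzb⟩ := hb
      rw [hT, mem_filter] at hz
      exact ⟨z, hz.1, hq'1 z hz.2, hzb⟩
    calc ∑ b ∈ T.image (fun z : GaussianInt ↦ z.im), ‖∑ z ∈ T.filter (fun z ↦ z.im = b), Φ z‖
        ≤ ∑ _b ∈ T.image (fun z : GaussianInt ↦ z.im), 2 * F := sum_le_sum hfib
      _ = (T.image (fun z : GaussianInt ↦ z.im)).card * (2 * F) := by rw [sum_const, nsmul_eq_mul]
      _ ≤ 3 * Real.sqrt u * (2 * F) := by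
          exact mul_le_mul_of_nonneg_right (card_image_im_le hu1r hTS) (by positivity)
  have hP := hpiece (fun z : GaussianInt ↦ |z.re| ≤ |z.im|) (fun z hz ↦ hz) (fun b a h ↦ h)
    (fun b a₁ a₂ a h1 h2 h0 ha1 ha2 ↦ by
      change |a| ≤ |b|; change |a₁| ≤ |b| at h1; change |a₂| ≤ |b| at h2
      rw [abs_of_nonneg h0] at h1; rw [abs_of_nonneg (by linarith)] at h2; rw [abs_of_nonneg (by linarith)]
      linarith)
    (fun b a₁ a₂ a h1 h2 h0 ha1 ha2 ↦ by
      change |a| ≤ |b|; change |a₁| ≤ |b| at h1; change |a₂| ≤ |b| at h2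
      rw [abs_of_neg (by linarith)] at h1; rw [abs_of_neg h0] at h2; rw [abs_of_neg (by linarith)]
      linarith)
  have hQ := hpiece (fun z : GaussianInt ↦ |z.re| < |z.im|) (fun z hz ↦ le_of_lt hz) (fun b a h ↦ le_of_lt h)
    (fun b a₁ a₂ a h1 h2 h0 ha1 ha2 ↦ by
      change |a| < |b|; change |a₁| < |b| at h1; change |a₂| < |b| at h2
      rw [abs_of_nonneg h0] at h1; rw [abs_of_nonneg (by linarith)] at h2; rw [abs_of_nonneg (by linarith)]
      linarith)
    (fun b a₁ a₂ a h1 h2 h0 ha1 ha2 ↦ by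
      change |a| < |b|; change |a₁| < |b| at h1; change |a₂| < |b| at h2
      rw [abs_of_neg (by linarith)] at h1; rw [abs_of_neg h0] at h2; rw [abs_of_neg (by linarith)]
      linarith)
  -- ### conclusion
  rw [hSsum, hsplit]
  calc ‖∑ z ∈ S.filter (fun z : GaussianInt ↦ |z.re| ≤ |z.im|), Φ z +
        ∑ z ∈ S.filter (fun z : GaussianInt ↦ |z.re| < |z.im|), Φ z‖
      ≤ ‖∑ z ∈ S.filter (fun z : GaussianInt ↦ |z.re| ≤ |z.im|), Φ z‖ +
          ‖∑ z ∈ S.filter (fun z : GaussianInt ↦ |z.re| < |z.im|), Φ z‖ := norm_add_le _ _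
    _ ≤ 3 * Real.sqrt u * (2 * F) + 3 * Real.sqrt u * (2 * F) := add_le_add hP hQ
    _ = 132 * (Real.sqrt u * Real.sqrt u) * Real.exp (-E) := by rw [hFdef]; ring
    _ ≤ 132 * (2 * M) * Real.exp (-E) := by rw [hsqu]; gcongr
    _ ≤ (18 * Real.exp 33 + 300) * (M * Real.exp (-E)) := by
        have : 0 ≤ M * Real.exp (-E) := by positivity
        have : 0 ≤ Real.exp 33 := by positivity
        nlinarith

end GaussianHecke

/-! ## Part C.  Harman's Lemma 11.6, unconditionally -/

namespace GaussianInt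

/-- **Harman's Lemma 11.6, unconditionally** (G. Harman, *Prime-Detecting Sieves*, Lemma 11.6 = (11.4.5), §11.4):
there is an absolute `C` with `|∑_{R ≤ |p|² < S} |p|^{2it} λ^m(p)| ≤ C S exp(−log S/(2(log TU)^{7/10}))` for
`R, U ≥ 2`, `T ≥ S ≥ R + exp((log UT)^{4/5})`, `1 ≤ m ≤ T`, `|t| ≤ U`.  The conditional Part A fed with the in-tree
proof of M. D. Coleman's zero-free region for the Hecke `L`-functions `L(s, λ^m)` of `ℚ(i)` (Mathematika 37 (1990),
Theorem 2 — Harman's reference for "the similar zero-free region"): Part B (Coleman's Theorem 1 for `ℚ(i)`), the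
Richert-type bound `GaussianHecke.exists_richert_of_latticeExpSumBound` and the Landau–Titchmarsh deduction
`GaussianHecke.exists_hasVKZeroFreeRegion_of_latticeExpSumBound`.
[cite: Harman2007, Lemma 11.6] [cite: ColemanMathematika1990, Theorem 2] -/
theorem harman_primeCharSum_bound_holds : harman_primeCharSum_bound := by
  obtain ⟨C, D, hC, hD, h⟩ := GaussianHecke.exists_latticeExpSumBound
  obtain ⟨c, hc, hVK⟩ := GaussianHecke.exists_hasVKZeroFreeRegion_of_latticeExpSumBound h hC hD
  exact harman_primeCharSum_bound_of_vk hc hVK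

end GaussianInt

end Literature.NumberTheory.LFunctions
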